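import Literature.Analysis.FunctionSpaces.MollificationLp
import HarnessLib

/-!
# Time mollification: even kernels on the line, half-kernel limits, and an integration by parts

Analysis/FunctionSpaces support file (serves the discharge of the Serrin–Prodi weak–strong
uniqueness theorem `Literature.Analysis.FluidPDE.weak_strong_uniqueness`, sub-fact `Literature.Analysis.FluidPDE.serrin_difference_energy_ineq`:
Serrin's "doubling of the time variable", Serrin 1963, §4; Sohr 2001, Thm. V.1.4.1; Galdi 2000,
Thm. 4.2). Elementary real-variable facts about mollification **in time** by the normalised
even bump kernels `ρ = φ.normed volume`, `φ : ContDiffBump (0 : ℝ)`: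

* `Literature.Analysis.FunctionSpaces.setIntegral_normed_Ioi`: an even unit-mass kernel has mass `1/2` on `(0, ∞)`;
* `Literature.Analysis.FunctionSpaces.tendsto_setIntegral_normed_sub_mul` / `Literature.Analysis.FunctionSpaces.tendsto_setIntegral_normed_mul`: the
  **half-kernel limits** `∫₀ᵗ ρₕ(t - σ) g(σ) dσ → ½ g(t⁻)` and `∫₀ᵗ ρₕ(σ) g(σ) dσ → ½ g(0⁺)` as
  `rOut → 0`, for `g` bounded and continuous on `(0, t)` with the one-sided limits;
* `Literature.Analysis.FunctionSpaces.setIntegral_deriv_mul_const_add_setIntegral`: the integration by parts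
  `∫₀ᵗ θ'(s) (c + ∫₀ˢ f) ds = θ(t)(c + ∫₀ᵗ f) - θ(0) c - ∫₀ᵗ θ f` for `θ ∈ C¹`, `f ∈ L¹(0,t)`
  (Fubini on the triangle `{τ < s}` and the fundamental theorem of calculus for `θ`);
* `Literature.Analysis.FunctionSpaces.tendsto_eLpNorm_timeConv_sub`, `Literature.Analysis.FunctionSpaces.ae_tendsto_timeConv`: for a jointly measurable
  `g : ℝ × X → F`, mollification in the first variable converges in `L^p(ℝ × X)` (`1 ≤ p < ∞`)
  and almost everywhere;
* `Literature.Analysis.FunctionSpaces.tendsto_integral_normed_mul_integral_inner` / `…_of_bound`: the resulting limits of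
  the mollified pairings `∫∫ ρₕ(s-σ) ⟨Φ(s), A(σ)⟩_{L²(X)} dσ ds → ∫ ⟨Φ(s), A(s)⟩ ds` on `(0,t)²`
  for `A, Φ ∈ L²((0,t) × X)` resp. `A ∈ L¹`, `Φ ∈ L^∞`;
* `Literature.Analysis.FunctionSpaces.lintegral_lintegral_normed_mul_mul_le`: the weighted Hölder bound
  `∫∫ ρ(s-σ) f(σ) g(s) ≤ ‖f‖_{p} ‖g‖_{q}`, `1/p + 1/q = 1`;
* `Literature.Analysis.FunctionSpaces.measurable_eLpNorm_slice` / `Literature.Analysis.FunctionSpaces.aemeasurable_eLpNorm_slice`: `s ↦ ‖g(s, ·)‖_{L^r(X)}` is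
  (a.e.) measurable, `r ∈ [0, ∞]`.

## Mathlib search

Mathlib (this pin) has bump functions and their normalisation (`ContDiffBump.normed`,
`normed_neg`, `integral_normed`), convolution and its a.e. convergence
(`ContDiffBump.ae_convolution_tendsto_right_of_locallyIntegrable`), Fubini–Tonelli, and
`integral_comp_abs`, dominated convergence; the tree has `L^p` convergence and a.e.
convergence of mollification (`Literature.Analysis.FunctionSpaces.tendsto_eLpNorm_normed_convolution_sub_self`,
`Literature.Analysis.FunctionSpaces.ae_tendsto_normed_convolution`). None of the listed statements exists as such (searched
`normed`, `convolution`, `Ioi`, `tendsto_setIntegral`, `essSup` + `measurable` in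
`Analysis/Calculus/BumpFunction`, `Analysis/Convolution`, `MeasureTheory/Integral`,
`MeasureTheory/Function`).

## References

* J. Serrin, *The initial value problem for the Navier–Stokes equations*, in: Nonlinear Problems
  (Madison 1962), Univ. Wisconsin Press 1963, §4.
* H. Sohr, *The Navier–Stokes Equations. An Elementary Functional Analytic Approach*,
  Birkhäuser 2001, Thm. V.1.4.1 (proof: mollification in time).
* L. C. Evans, *Partial Differential Equations*, 2nd ed. (AMS 2010), App. C.4.
-/

noncomputable section

open MeasureTheory TopologicalSpace Set Function Filter Topology ContinuousLinearMap Metric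
open scoped ENNReal NNReal Convolution RealInnerProductSpace

namespace Literature.Analysis.FunctionSpaces

/-! ### Even unit-mass kernels on the line -/

section Kernel

variable (φ : ContDiffBump (0 : ℝ))

/-- The normalised bump kernel is even: `ρ(a - b) = ρ(b - a)`. [folklore] -/
theorem normed_sub_comm (a b : ℝ) : φ.normed volume (a - b) = φ.normed volume (b - a) := by
  rw [← neg_sub b a, φ.normed_neg]

/-- The normalised bump kernel vanishes outside `(-rOut, rOut)`. [folklore] -/
theorem normed_eq_zero_of_rOut_le_abs {x : ℝ} (hx : φ.rOut ≤ |x|) : φ.normed volume x = 0 := by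
  have hx' : x ∉ Function.support (φ.normed volume) := by
    rw [φ.support_normed_eq, Metric.mem_ball, dist_zero_right, Real.norm_eq_abs, not_lt]
    exact hx
  simpa [Function.mem_support] using hx'

/-- The normalised bump kernel is bounded. [folklore] -/
theorem exists_normed_le : ∃ C, 0 ≤ C ∧ ∀ x, φ.normed volume x ≤ C := by
  obtain ⟨C, hC⟩ := (φ.continuous_normed (μ := (volume : Measure ℝ))).bounded_above_of_compact_support
    (φ.hasCompactSupport_normed (μ := (volume : Measure ℝ)))
  refine ⟨C, (norm_nonneg _).trans (hC 0), fun x => le_trans ?_ (hC x)⟩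
  rw [Real.norm_eq_abs]
  exact le_abs_self _

/-- **Half mass.** An even unit-mass kernel has mass `1/2` on `(0, ∞)`:
`∫_{(0,∞)} ρ = 1/2` (from `∫ ρ(|x|) dx = 2 ∫_{(0,∞)} ρ`). [folklore] -/
theorem setIntegral_normed_Ioi : ∫ x in Ioi (0 : ℝ), φ.normed volume x = 1 / 2 := by
  have h := integral_comp_abs (f := φ.normed volume)
  have h2 : (fun x : ℝ => φ.normed volume |x|) = φ.normed volume := by
    ext x
    rcases le_or_gt 0 x with hx | hx
    · rw [abs_of_nonneg hx]
    · rw [abs_of_neg hx, φ.normed_neg]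
  rw [h2, φ.integral_normed] at h
  linarith

/-- `∫_{(0,t)} ρ = 1/2` as soon as `rOut < t`. [folklore] -/
theorem setIntegral_Ioo_normed {t : ℝ} (ht : φ.rOut < t) :
    ∫ σ in Ioo 0 t, φ.normed volume σ = 1 / 2 := by
  rw [← setIntegral_normed_Ioi φ]
  refine (setIntegral_eq_of_subset_of_forall_sdiff_eq_zero measurableSet_Ioi Ioo_subset_Ioi_self
    fun x hx => ?_).symm
  apply normed_eq_zero_of_rOut_le_abs
  have hx0 : 0 < x := hx.1
  have hxt : t ≤ x := by
    by_contra h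
    exact hx.2 ⟨hx0, not_le.1 h⟩
  rw [abs_of_pos hx0]
  exact ht.le.trans hxt

/-- Set integrals over `(a, b)` are interval integrals. [folklore] -/
theorem setIntegral_Ioo_eq_intervalIntegral {F : Type*} [NormedAddCommGroup F] [NormedSpace ℝ F]
    (f : ℝ → F) {a b : ℝ} (hab : a ≤ b) :
    ∫ x in Ioo a b, f x = ∫ x in a..b, f x := by
  rw [intervalIntegral.integral_of_le hab, setIntegral_congr_set Ioo_ae_eq_Ioc]

/-- Reflection `σ ↦ t - σ` of `(0, t)`: `∫_{(0,t)} f(t - σ) dσ = ∫_{(0,t)} f`. [folklore] -/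
theorem setIntegral_Ioo_comp_sub_left {F : Type*} [NormedAddCommGroup F] [NormedSpace ℝ F]
    (f : ℝ → F) {t : ℝ} (ht : 0 ≤ t) :
    ∫ σ in Ioo 0 t, f (t - σ) = ∫ σ in Ioo 0 t, f σ := by
  rw [setIntegral_Ioo_eq_intervalIntegral _ ht, setIntegral_Ioo_eq_intervalIntegral _ ht,
    intervalIntegral.integral_comp_sub_left (fun x => f x) t]
  simp

/-- `∫_{(0,t)} ρ(t - σ) dσ = 1/2` as soon as `rOut < t`. [folklore] -/
theorem setIntegral_Ioo_normed_sub {t : ℝ} (ht : φ.rOut < t) :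
    ∫ σ in Ioo 0 t, φ.normed volume (t - σ) = 1 / 2 := by
  rw [setIntegral_Ioo_comp_sub_left (fun x => φ.normed volume x) (φ.rOut_pos.trans ht).le]
  exact setIntegral_Ioo_normed φ ht

end Kernel

/-! ### Half-kernel limits -/

section HalfKernel

variable {ι : Type*} {φ : ι → ContDiffBump (0 : ℝ)} {l : Filter ι}

/-- **Half-kernel limit from the left.** Let `g` be continuous and bounded on `(0, t)` with
`g(σ) → L` as `σ → t⁻`, and let `ρᵢ` be even normalised bump kernels with `rOut(ρᵢ) → 0`. Then
`∫_{(0,t)} ρᵢ(t - σ) g(σ) dσ → L/2` (Serrin 1963, §4, the boundary terms of the time-mollified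
identity; Sohr 2001, proof of Thm. V.1.4.1). [cite: Serrin1963, §4] -/
theorem tendsto_setIntegral_normed_sub_mul (hφ : Tendsto (fun i => (φ i).rOut) l (𝓝 0))
    {t : ℝ} (ht : 0 < t) {g : ℝ → ℝ} {L B : ℝ} (hg : ContinuousOn g (Ioo 0 t))
    (hB : ∀ σ ∈ Ioo 0 t, |g σ| ≤ B) (hlim : Tendsto g (𝓝[<] t) (𝓝 L)) :
    Tendsto (fun i => ∫ σ in Ioo 0 t, (φ i).normed volume (t - σ) * g σ) l (𝓝 (L / 2)) := by
  rw [Metric.tendsto_nhds]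
  intro ε hε
  have h1 : ∀ᶠ σ in 𝓝[<] t, dist (g σ) L < ε := Metric.tendsto_nhds.1 hlim ε hε
  obtain ⟨t', ht't, hsub⟩ := mem_nhdsLT_iff_exists_Ioo_subset.1 h1
  set d : ℝ := t - max t' 0 with hd
  have hd0 : 0 < d := by
    rw [hd, sub_pos]; exact max_lt ht't ht
  have hdt : d ≤ t := by
    rw [hd]; linarith [le_max_right t' 0]
  filter_upwards [(tendsto_order.1 hφ).2 d hd0] with i hi
  have hit : (φ i).rOut < t := lt_of_lt_of_le hi hdt
  -- integrability of the two integrands on `(0, t)`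
  obtain ⟨C, hC0, hC⟩ := exists_normed_le (φ i)
  have hρc : Continuous fun σ => (φ i).normed volume (t - σ) :=
    (φ i).continuous_normed.comp (continuous_const.sub continuous_id)
  have hint : IntegrableOn (fun σ => (φ i).normed volume (t - σ) * g σ) (Ioo 0 t) := by
    have hm : AEStronglyMeasurable (fun σ => (φ i).normed volume (t - σ) * g σ)
        (volume.restrict (Ioo 0 t)) :=
      (hρc.aestronglyMeasurable.restrict).mul (hg.aestronglyMeasurable measurableSet_Ioo)
    refine Integrable.mono' (integrable_const (C * B)) hm ?_
    filter_upwards [ae_restrict_mem measurableSet_Ioo] with σ hσ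
    rw [norm_mul, Real.norm_eq_abs, Real.norm_eq_abs, abs_of_nonneg ((φ i).nonneg_normed _)]
    exact mul_le_mul (hC _) (hB σ hσ) (abs_nonneg _) hC0
  have hintρ : IntegrableOn (fun σ => (φ i).normed volume (t - σ)) (Ioo 0 t) :=
    hρc.integrableOn_Icc.mono_set Ioo_subset_Icc_self
  -- rewrite the difference as one integral
  have hdiff : (∫ σ in Ioo 0 t, (φ i).normed volume (t - σ) * g σ) - L / 2 =
      ∫ σ in Ioo 0 t, (φ i).normed volume (t - σ) * (g σ - L) := by
    have : L / 2 = ∫ σ in Ioo 0 t, (φ i).normed volume (t - σ) * L := by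
      rw [integral_mul_const, setIntegral_Ioo_normed_sub (φ i) hit]; ring
    rw [this, ← integral_sub hint (hintρ.mul_const L)]
    congr 1; ext σ; ring
  rw [Real.dist_eq, hdiff]
  -- pointwise bound `ρᵢ(t - σ) |g σ - L| ≤ ρᵢ(t - σ) ε` on `(0, t)`
  have hpt : ∀ σ ∈ Ioo 0 t, ‖(φ i).normed volume (t - σ) * (g σ - L)‖ ≤
      (φ i).normed volume (t - σ) * ε := by
    intro σ hσ
    rw [norm_mul, Real.norm_eq_abs, abs_of_nonneg ((φ i).nonneg_normed _)]
    rcases le_or_gt σ (max t' 0) with hle | hgt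
    · have hz : (φ i).normed volume (t - σ) = 0 := by
        apply normed_eq_zero_of_rOut_le_abs
        rw [abs_of_pos (by linarith [hσ.2])]
        linarith
      rw [hz, zero_mul, zero_mul]
    · have hσ' : σ ∈ Ioo t' t := ⟨lt_of_le_of_lt (le_max_left _ _) hgt, hσ.2⟩
      have := hsub hσ'
      rw [mem_setOf_eq, Real.dist_eq] at this
      exact mul_le_mul_of_nonneg_left this.le ((φ i).nonneg_normed _)
  calc |∫ σ in Ioo 0 t, (φ i).normed volume (t - σ) * (g σ - L)|
      ≤ ∫ σ in Ioo 0 t, (φ i).normed volume (t - σ) * ε := by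
        rw [← Real.norm_eq_abs]
        refine norm_integral_le_of_norm_le (hintρ.mul_const ε) ?_
        filter_upwards [ae_restrict_mem measurableSet_Ioo] with σ hσ using hpt σ hσ
    _ = ε / 2 := by rw [integral_mul_const, setIntegral_Ioo_normed_sub (φ i) hit]; ring
    _ < ε := by linarith

/-- **Half-kernel limit at `0⁺`.** Let `g` be continuous and bounded on `(0, t)` with
`g(σ) → L` as `σ → 0⁺`, and let `ρᵢ` be even normalised bump kernels with `rOut(ρᵢ) → 0`. Then
`∫_{(0,t)} ρᵢ(σ) g(σ) dσ → L/2` (Serrin 1963, §4, the initial terms of the time-mollified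
identity). Reduced to the left-limit version by the reflection `σ ↦ t - σ`. [cite: Serrin1963, §4] -/
theorem tendsto_setIntegral_normed_mul (hφ : Tendsto (fun i => (φ i).rOut) l (𝓝 0))
    {t : ℝ} (ht : 0 < t) {g : ℝ → ℝ} {L B : ℝ} (hg : ContinuousOn g (Ioo 0 t))
    (hB : ∀ σ ∈ Ioo 0 t, |g σ| ≤ B) (hlim : Tendsto g (𝓝[>] 0) (𝓝 L)) :
    Tendsto (fun i => ∫ σ in Ioo 0 t, (φ i).normed volume σ * g σ) l (𝓝 (L / 2)) := by
  have hmaps : MapsTo (fun σ => t - σ) (Ioo 0 t) (Ioo 0 t) := fun σ hσ =>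
    ⟨by linarith [hσ.2], by linarith [hσ.1]⟩
  have hg' : ContinuousOn (fun σ => g (t - σ)) (Ioo 0 t) :=
    hg.comp (continuous_const.sub continuous_id).continuousOn hmaps
  have hB' : ∀ σ ∈ Ioo 0 t, |g (t - σ)| ≤ B := fun σ hσ => hB _ (hmaps hσ)
  have hlim' : Tendsto (fun σ => g (t - σ)) (𝓝[<] t) (𝓝 L) := by
    refine hlim.comp ?_
    refine tendsto_nhdsWithin_of_tendsto_nhds_of_eventually_within _ ?_ ?_
    · have : Tendsto (fun σ : ℝ => t - σ) (𝓝 t) (𝓝 (t - t)) :=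
        (continuous_const.sub continuous_id).tendsto t
      rw [sub_self] at this
      exact this.mono_left nhdsWithin_le_nhds
    · filter_upwards [self_mem_nhdsWithin] with σ hσ
      exact sub_pos.2 (mem_Iio.1 hσ)
  have h := tendsto_setIntegral_normed_sub_mul hφ ht hg' hB' hlim'
  refine h.congr fun i => ?_
  exact setIntegral_Ioo_comp_sub_left (fun σ => (φ i).normed volume σ * g σ) ht.le

end HalfKernel

/-! ### Integration by parts against a primitive -/

section IBP

/-- The fundamental theorem of calculus on `(a, b)` for a `C¹` function, set-integral form. [folklore] -/
theorem setIntegral_Ioo_deriv_eq_sub {θ : ℝ → ℝ} (hθ : ContDiff ℝ 1 θ) {a b : ℝ} (hab : a ≤ b) :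
    ∫ s in Ioo a b, deriv θ s = θ b - θ a := by
  rw [setIntegral_Ioo_eq_intervalIntegral _ hab]
  exact intervalIntegral.integral_deriv_eq_sub (fun x _ => (hθ.differentiable one_ne_zero) x)
    ((hθ.continuous_deriv le_rfl).intervalIntegrable _ _)

/-- **Integration by parts against a primitive.** For `θ ∈ C¹(ℝ)`, `f ∈ L¹(0, t)` and `c ∈ ℝ`,
`∫₀ᵗ θ'(s) (c + ∫₀ˢ f) ds = θ(t) (c + ∫₀ᵗ f) - θ(0) c - ∫₀ᵗ θ(s) f(s) ds`
(Serrin 1963, §4: the time-mollified weak formulation is obtained by testing the integrated form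
`⟨u(s), Ψ⟩ = ⟨u₀, Ψ⟩ + ∫₀ˢ …` against `ρₕ(· - σ)`). Proof: Fubini on the triangle
`{0 < τ < s < t}` and the fundamental theorem of calculus for `θ` on `[τ, t]`; no
differentiability of the primitive is used. [cite: Serrin1963, §4] -/
theorem setIntegral_deriv_mul_const_add_setIntegral {t : ℝ} (ht : 0 < t) {θ : ℝ → ℝ}
    (hθ : ContDiff ℝ 1 θ) {f : ℝ → ℝ} (hf : IntegrableOn f (Ioo 0 t)) (c : ℝ) :
    ∫ s in Ioo 0 t, deriv θ s * (c + ∫ τ in Ioo 0 s, f τ) =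
      θ t * (c + ∫ τ in Ioo 0 t, f τ) - θ 0 * c - ∫ s in Ioo 0 t, θ s * f s := by
  -- WLOG `f` vanishes outside `(0, t)`
  set g : ℝ → ℝ := (Ioo 0 t).indicator f with hg
  have hgi : IntegrableOn g (Ioo 0 t) := (hf.integrable_indicator measurableSet_Ioo).integrableOn
  have hgf : ∀ s, s ≤ t → ∫ τ in Ioo 0 s, g τ = ∫ τ in Ioo 0 s, f τ := fun s hs =>
    setIntegral_congr_fun measurableSet_Ioo fun τ hτ =>
      indicator_of_mem (show τ ∈ Ioo 0 t from ⟨hτ.1, lt_of_lt_of_le hτ.2 hs⟩) f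
  have hgf' : ∀ h : ℝ → ℝ, ∫ s in Ioo 0 t, h s * g s = ∫ s in Ioo 0 t, h s * f s := fun h =>
    setIntegral_congr_fun measurableSet_Ioo fun s hs => by rw [hg, indicator_of_mem hs]
  -- `θ`, `θ'` are integrable on `(0, t)`
  have hθc : Continuous θ := hθ.continuous
  have hθ'c : Continuous (deriv θ) := hθ.continuous_deriv le_rfl
  have hθ'i : IntegrableOn (deriv θ) (Ioo 0 t) :=
    hθ'c.integrableOn_Icc.mono_set Ioo_subset_Icc_self
  obtain ⟨D, hD⟩ : ∃ D, ∀ s ∈ Icc 0 t, ‖θ s‖ ≤ D :=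
    isCompact_Icc.exists_bound_of_continuousOn hθc.continuousOn
  have hθgi : IntegrableOn (fun s => θ s * g s) (Ioo 0 t) := by
    refine Integrable.mono' (hgi.norm.const_mul D)
      ((hθc.aestronglyMeasurable.restrict).mul hgi.aestronglyMeasurable) ?_
    filter_upwards [ae_restrict_mem measurableSet_Ioo] with s hs
    rw [norm_mul]
    exact mul_le_mul_of_nonneg_right (hD s (Ioo_subset_Icc_self hs)) (norm_nonneg _)
  -- the triangle integrand
  set F : ℝ → ℝ → ℝ := fun s τ => (Iio s).indicator (fun τ => deriv θ s * g τ) τ with hF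
  have hFK : uncurry F = {p : ℝ × ℝ | p.2 < p.1}.indicator fun p => deriv θ p.1 * g p.2 := by
    ext p
    simp only [hF, uncurry, indicator_apply, mem_Iio, mem_setOf_eq]
  have hFi : Integrable (uncurry F)
      ((volume.restrict (Ioo 0 t)).prod (volume.restrict (Ioo 0 t))) := by
    rw [hFK]
    exact (hθ'i.mul_prod hgi).indicator (measurableSet_lt measurable_snd measurable_fst)
  -- inner integral in `τ` for fixed `s`
  have hinner₁ : ∀ s ∈ Ioo 0 t, ∫ τ in Ioo 0 t, F s τ = deriv θ s * ∫ τ in Ioo 0 s, g τ := by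
    intro s hs
    simp only [hF]
    rw [setIntegral_indicator measurableSet_Iio, Ioo_inter_Iio, min_eq_right hs.2.le,
      integral_const_mul]
  -- inner integral in `s` for fixed `τ`
  have hinner₂ : ∀ τ ∈ Ioo 0 t, ∫ s in Ioo 0 t, F s τ = (θ t - θ τ) * g τ := by
    intro τ hτ
    have hpt : (fun s => F s τ) = (Ioi τ).indicator fun s => deriv θ s * g τ := by
      ext s
      simp only [hF, indicator_apply, mem_Iio, mem_Ioi]
    rw [hpt, setIntegral_indicator measurableSet_Ioi, Ioo_inter_Ioi, max_eq_right hτ.1.le,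
      integral_mul_const, setIntegral_Ioo_deriv_eq_sub hθ hτ.2.le]
  -- Fubini
  have hswap := integral_integral_swap hFi
  have hL : ∫ s in Ioo 0 t, ∫ τ in Ioo 0 t, F s τ =
      ∫ s in Ioo 0 t, deriv θ s * ∫ τ in Ioo 0 s, f τ := by
    refine setIntegral_congr_fun measurableSet_Ioo fun s hs => ?_
    rw [hinner₁ s hs, hgf s hs.2.le]
  have hR : ∫ τ in Ioo 0 t, ∫ s in Ioo 0 t, F s τ =
      θ t * (∫ τ in Ioo 0 t, f τ) - ∫ s in Ioo 0 t, θ s * f s := by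
    rw [setIntegral_congr_fun measurableSet_Ioo hinner₂]
    have : (fun τ => (θ t - θ τ) * g τ) = fun τ => θ t * g τ - θ τ * g τ := by
      ext τ; ring
    rw [this, integral_sub (hgi.const_mul _) hθgi, integral_const_mul, hgf' θ]
    have h1 := hgf' (fun _ => (1 : ℝ))
    simp only [one_mul] at h1
    rw [h1]
  -- integrability of `s ↦ θ'(s) ∫₀ˢ f` from Fubini
  have hPi : IntegrableOn (fun s => deriv θ s * ∫ τ in Ioo 0 s, f τ) (Ioo 0 t) := by
    have h := hFi.integral_prod_left
    refine (integrableOn_congr_fun (fun s hs => ?_) measurableSet_Ioo).1 h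
    change ∫ τ in Ioo 0 t, F s τ = _
    rw [hinner₁ s hs, hgf s hs.2.le]
  -- assemble
  have hsplit : ∫ s in Ioo 0 t, deriv θ s * (c + ∫ τ in Ioo 0 s, f τ) =
      (∫ s in Ioo 0 t, deriv θ s * c) + ∫ s in Ioo 0 t, deriv θ s * ∫ τ in Ioo 0 s, f τ := by
    rw [← integral_add (hθ'i.mul_const c) hPi]
    congr 1; ext s; ring
  rw [hsplit, integral_mul_const, setIntegral_Ioo_deriv_eq_sub hθ ht.le, ← hL, hswap, hR]
  ring

end IBP

/-! ### Mollification in the first variable of a jointly measurable function -/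

section TimeMollification

variable {X : Type*} [MeasurableSpace X] {μ : Measure X} [SFinite μ]
variable {F : Type*} [NormedAddCommGroup F] [NormedSpace ℝ F]

/-- **Joint measurability of the time mollification.** For a jointly measurable
`g : ℝ × X → F` and a bump kernel `ρ`, the mollification in the first variable
`(s, x) ↦ (ρ ⋆ g(·, x))(s) = ∫ ρ(τ) g(s - τ, x) dτ` is jointly measurable (a parametric integral
of a jointly measurable integrand; Mathlib's `StronglyMeasurable.integral_prod_right'`). [folklore] -/
theorem stronglyMeasurable_timeConv (φ : ContDiffBump (0 : ℝ)) {g : ℝ → X → F}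
    (hg : StronglyMeasurable (uncurry g)) :
    StronglyMeasurable fun z : ℝ × X =>
      (φ.normed volume ⋆[lsmul ℝ ℝ, volume] fun σ => g σ z.2) z.1 := by
  have h1 : StronglyMeasurable fun q : (ℝ × X) × ℝ =>
      φ.normed volume q.2 • g (q.1.1 - q.2) q.1.2 := by
    have hc : StronglyMeasurable fun q : (ℝ × X) × ℝ => φ.normed volume q.2 :=
      (φ.continuous_normed.measurable.comp measurable_snd).stronglyMeasurable
    have hm : StronglyMeasurable fun q : (ℝ × X) × ℝ => g (q.1.1 - q.2) q.1.2 :=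
      hg.comp_measurable ((measurable_fst.fst.sub measurable_snd).prodMk measurable_fst.snd)
    exact hc.smul hm
  have h2 := h1.integral_prod_right' (ν := (volume : Measure ℝ))
  have heq : (fun z : ℝ × X => (φ.normed volume ⋆[lsmul ℝ ℝ, volume] fun σ => g σ z.2) z.1) =
      fun z => ∫ τ, φ.normed volume τ • g (z.1 - τ) z.2 := by
    funext z
    simp only [convolution_def, lsmul_apply]
  rw [heq]
  exact h2

/-- **Fibrewise Young inequality.** Mollification in the first variable does not increase the
`L^p(ℝ × X)` norm, `1 ≤ p < ∞` (Young's contraction `‖ρ ⋆ h‖_p ≤ ‖h‖_p` on each fibre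
`h = g(·, x)` and Tonelli). [folklore] -/
theorem eLpNorm_timeConv_le (φ : ContDiffBump (0 : ℝ)) {g : ℝ → X → F}
    (hg : StronglyMeasurable (uncurry g)) {p : ℝ≥0∞} (hp : 1 ≤ p) (hp' : p ≠ ∞) :
    eLpNorm (fun z : ℝ × X => (φ.normed volume ⋆[lsmul ℝ ℝ, volume] fun σ => g σ z.2) z.1) p
        ((volume : Measure ℝ).prod μ) ≤ eLpNorm (uncurry g) p ((volume : Measure ℝ).prod μ) := by
  have hp0 : p ≠ 0 := (zero_lt_one.trans_le hp).ne'
  have hpr : 0 < p.toReal := ENNReal.toReal_pos hp0 hp'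
  have hMm := stronglyMeasurable_timeConv φ hg
  rw [eLpNorm_eq_lintegral_rpow_enorm_toReal hp0 hp', eLpNorm_eq_lintegral_rpow_enorm_toReal hp0 hp']
  refine ENNReal.rpow_le_rpow ?_ (by positivity)
  rw [lintegral_prod_symm _
      (hMm.aestronglyMeasurable.enorm.pow_const _),
    lintegral_prod_symm _ (hg.aestronglyMeasurable.enorm.pow_const _)]
  refine lintegral_mono fun x => ?_
  have hgx := (hg.of_uncurry_right (y := x))
  have h := eLpNorm_normed_convolution_le_haar (μ := (volume : Measure ℝ)) φ
    hgx.aestronglyMeasurable hp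
  have h' := ENNReal.rpow_le_rpow h hpr.le
  rw [eLpNorm_eq_eLpNorm' hp0 hp', eLpNorm_eq_eLpNorm' hp0 hp',
    ← lintegral_rpow_enorm_eq_rpow_eLpNorm' hpr, ← lintegral_rpow_enorm_eq_rpow_eLpNorm' hpr] at h'
  exact h'

/-- **Mollification in the first variable converges in `L^p(ℝ × X)`.** Let `g : ℝ × X → F` be
jointly measurable with `‖g‖_{L^p(ℝ × X)} < ∞`, `1 ≤ p < ∞`, and let `ρᵢ` be normalised bump
kernels with `rOut(ρᵢ) → 0`. Then `‖ρᵢ ⋆₁ g - g‖_{L^p(ℝ × X)} → 0` (Serrin 1963, §4: time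
mollifications of `∇u`, `u` converge in `L²((0,T) × ℝ³)`; Sohr 2001, Lemma II.1.6.x-type
statement for Bochner spaces). Proof: by Tonelli the `p`-th power of the norm is
`∫ₓ ‖ρᵢ ⋆ g(·,x) - g(·,x)‖_{L^p(ℝ)}^p dμ`; for a.e. `x` the fibre `g(·,x)` is in `L^p(ℝ)`, so the
integrand tends to `0` (accepted `tendsto_eLpNorm_normed_convolution_sub_self`), and it is
dominated by `2^p ‖g(·,x)‖_p^p ∈ L¹(μ)` (Young); dominated convergence. [cite: Serrin1963, §4] -/
theorem tendsto_eLpNorm_timeConv_sub [CompleteSpace F] {ι : Type*} {φ : ι → ContDiffBump (0 : ℝ)}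
    {l : Filter ι} [l.IsCountablyGenerated] (hφ : Tendsto (fun i => (φ i).rOut) l (𝓝 0))
    {g : ℝ → X → F} (hg : StronglyMeasurable (uncurry g)) {p : ℝ≥0∞} (hp : 1 ≤ p) (hp' : p ≠ ∞)
    (hgp : eLpNorm (uncurry g) p ((volume : Measure ℝ).prod μ) < ∞) :
    Tendsto (fun i => eLpNorm (fun z : ℝ × X =>
      ((φ i).normed volume ⋆[lsmul ℝ ℝ, volume] fun σ => g σ z.2) z.1 - g z.1 z.2) p
        ((volume : Measure ℝ).prod μ)) l (𝓝 0) := by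
  have hp0 : p ≠ 0 := (zero_lt_one.trans_le hp).ne'
  have hpr : 0 < p.toReal := ENNReal.toReal_pos hp0 hp'
  -- the differences and their fibre norms
  set D : ι → ℝ × X → F := fun i z =>
    ((φ i).normed volume ⋆[lsmul ℝ ℝ, volume] fun σ => g σ z.2) z.1 - g z.1 z.2 with hD
  have hDm : ∀ i, StronglyMeasurable (D i) := fun i =>
    (stronglyMeasurable_timeConv (φ i) hg).sub hg
  set T : ι → X → ℝ≥0∞ := fun i x => ∫⁻ s, ‖D i (s, x)‖ₑ ^ p.toReal with hT
  set N : X → ℝ≥0∞ := fun x => ∫⁻ s, ‖g s x‖ₑ ^ p.toReal with hN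
  have hNm : Measurable N := (hg.enorm.pow_const _).lintegral_prod_left'
  have hTm : ∀ i, Measurable (T i) := fun i => ((hDm i).enorm.pow_const _).lintegral_prod_left'
  -- fibre identities
  have hgx : ∀ x, AEStronglyMeasurable (fun σ => g σ x) volume := fun x =>
    ((hg.of_uncurry_right (y := x))).aestronglyMeasurable
  have hNx : ∀ x, N x = eLpNorm (fun σ => g σ x) p volume ^ p.toReal := fun x => by
    rw [hN, eLpNorm_eq_eLpNorm' hp0 hp', ← lintegral_rpow_enorm_eq_rpow_eLpNorm' hpr]
  have hTx : ∀ i x, T i x = eLpNorm (((φ i).normed volume ⋆[lsmul ℝ ℝ, volume] fun σ => g σ x) -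
      fun σ => g σ x) p volume ^ p.toReal := fun i x => by
    rw [hT, eLpNorm_eq_eLpNorm' hp0 hp', ← lintegral_rpow_enorm_eq_rpow_eLpNorm' hpr]
    rfl
  -- total norms via Tonelli
  have hNtot : ∫⁻ x, N x ∂μ = eLpNorm (uncurry g) p ((volume : Measure ℝ).prod μ) ^ p.toReal := by
    rw [eLpNorm_eq_eLpNorm' hp0 hp', ← lintegral_rpow_enorm_eq_rpow_eLpNorm' hpr,
      lintegral_prod_symm _ (hg.aestronglyMeasurable.enorm.pow_const _)]
    rfl
  have hTtot : ∀ i, eLpNorm (D i) p ((volume : Measure ℝ).prod μ) =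
      (∫⁻ x, T i x ∂μ) ^ (1 / p.toReal) := fun i => by
    rw [eLpNorm_eq_lintegral_rpow_enorm_toReal hp0 hp',
      lintegral_prod_symm _ ((hDm i).aestronglyMeasurable.enorm.pow_const _)]
  -- domination `T i x ≤ 2^p N x`
  have hbound : ∀ i x, T i x ≤ (2 : ℝ≥0∞) ^ p.toReal * N x := by
    intro i x
    rw [hTx, hNx, ← ENNReal.mul_rpow_of_nonneg _ _ hpr.le]
    refine ENNReal.rpow_le_rpow ?_ hpr.le
    have hconv : AEStronglyMeasurable
        ((φ i).normed volume ⋆[lsmul ℝ ℝ, volume] fun σ => g σ x) volume :=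
      ((stronglyMeasurable_timeConv (X := X) (φ i) hg).comp_measurable
        (measurable_id.prodMk measurable_const)).aestronglyMeasurable
    calc eLpNorm (((φ i).normed volume ⋆[lsmul ℝ ℝ, volume] fun σ => g σ x) - fun σ => g σ x)
          p volume
        ≤ eLpNorm ((φ i).normed volume ⋆[lsmul ℝ ℝ, volume] fun σ => g σ x) p volume +
            eLpNorm (fun σ => g σ x) p volume := eLpNorm_sub_le hconv (hgx x) hp
      _ ≤ eLpNorm (fun σ => g σ x) p volume + eLpNorm (fun σ => g σ x) p volume := by
          gcongr
          exact eLpNorm_normed_convolution_le_haar (μ := (volume : Measure ℝ)) (φ i) (hgx x) hp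
      _ = 2 * eLpNorm (fun σ => g σ x) p volume := by rw [two_mul]
  -- a.e. fibre is in `L^p`
  have hfin : ∫⁻ x, N x ∂μ ≠ ∞ := by
    rw [hNtot]
    exact (ENNReal.rpow_lt_top_of_nonneg hpr.le hgp.ne).ne
  have hae : ∀ᵐ x ∂μ, N x < ∞ := ae_lt_top hNm hfin
  have hlim : ∀ᵐ x ∂μ, Tendsto (fun i => T i x) l (𝓝 0) := by
    filter_upwards [hae] with x hx
    have hmem : MemLp (fun σ => g σ x) p volume := by
      refine ⟨hgx x, ?_⟩
      rw [hNx] at hx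
      exact (ENNReal.rpow_lt_top_iff_of_pos hpr).1 hx
    have h := tendsto_eLpNorm_normed_convolution_sub_self (μ := (volume : Measure ℝ)) hφ hp hp'
      hmem
    have h2 : Tendsto (fun i => eLpNorm (((φ i).normed volume ⋆[lsmul ℝ ℝ, volume]
        fun σ => g σ x) - fun σ => g σ x) p volume ^ p.toReal) l (𝓝 0) := by
      have := ((ENNReal.continuous_rpow_const (y := p.toReal)).tendsto (0 : ℝ≥0∞)).comp h
      rwa [ENNReal.zero_rpow_of_pos hpr] at this
    simpa only [hTx] using h2
  have hDCT : Tendsto (fun i => ∫⁻ x, T i x ∂μ) l (𝓝 (∫⁻ _ : X, (0 : ℝ≥0∞) ∂μ)) := by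
    refine tendsto_lintegral_filter_of_dominated_convergence (fun x => (2 : ℝ≥0∞) ^ p.toReal * N x)
      (Eventually.of_forall hTm) (Eventually.of_forall fun i => ae_of_all _ (hbound i)) ?_ hlim
    rw [lintegral_const_mul _ hNm]
    exact ENNReal.mul_ne_top (ENNReal.rpow_ne_top_of_nonneg hpr.le ENNReal.ofNat_ne_top) hfin
  rw [lintegral_zero] at hDCT
  have hfinal : Tendsto (fun i => (∫⁻ x, T i x ∂μ) ^ (1 / p.toReal)) l (𝓝 0) := by
    have := ((ENNReal.continuous_rpow_const (y := 1 / p.toReal)).tendsto (0 : ℝ≥0∞)).comp hDCT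
    rwa [ENNReal.zero_rpow_of_pos (by positivity)] at this
  refine hfinal.congr fun i => ?_
  rw [← hTtot i]

/-- **Mollification in the first variable converges almost everywhere.** Let `g : ℝ × X → F`
be jointly measurable with a.e. fibre `g(·, x)` locally integrable, and let `ρₙ` be normalised
bump kernels with `rOut → 0` and `rOut ≤ 2 rIn`. Then `(ρₙ ⋆ g(·,x))(s) → g(s,x)` for
`(vol × μ)`-a.e. `(s, x)` (Lebesgue differentiation on each fibre, Mathlib's
`ContDiffBump.ae_convolution_tendsto_right_of_locallyIntegrable`, and measurability of the
convergence set to pass from "a.e. `x`, a.e. `s`" to the product). [folklore] -/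
theorem ae_tendsto_timeConv [CompleteSpace F] {φ : ℕ → ContDiffBump (0 : ℝ)}
    (hφ : Tendsto (fun n => (φ n).rOut) atTop (𝓝 0)) (h'φ : ∀ n, (φ n).rOut ≤ 2 * (φ n).rIn)
    {g : ℝ → X → F} (hg : StronglyMeasurable (uncurry g))
    (hloc : ∀ᵐ x ∂μ, LocallyIntegrable (fun σ => g σ x) volume) :
    ∀ᵐ z ∂((volume : Measure ℝ).prod μ), Tendsto (fun n =>
      ((φ n).normed volume ⋆[lsmul ℝ ℝ, volume] fun σ => g σ z.2) z.1) atTop (𝓝 (g z.1 z.2)) := by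
  set M : ℕ → ℝ × X → F := fun n z =>
    ((φ n).normed volume ⋆[lsmul ℝ ℝ, volume] fun σ => g σ z.2) z.1 with hM
  have hMm : ∀ n, StronglyMeasurable (M n) := fun n => stronglyMeasurable_timeConv (φ n) hg
  set S : Set (ℝ × X) := {z | Tendsto (fun n => dist (M n z) (uncurry g z)) atTop (𝓝 0)} with hS
  have hSm : MeasurableSet S := by
    have h := measurableSet_tendsto_fun (l := atTop) (γ := ℝ)
      (f := fun n z => dist (M n z) (uncurry g z)) (g := fun _ => (0 : ℝ))
      (fun n => ((hMm n).dist hg).measurable) measurable_const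
    exact h
  -- fibrewise: for a.e. `x`, a.e. `s`
  have hfib : ∀ᵐ x ∂μ, ∀ᵐ s ∂(volume : Measure ℝ), (s, x) ∈ S := by
    filter_upwards [hloc] with x hx
    filter_upwards [ae_tendsto_normed_convolution hφ h'φ hx] with s hs
    simp only [hS, mem_setOf_eq]
    exact (tendsto_iff_dist_tendsto_zero.1 hs)
  have h1 : ∀ᵐ w ∂(μ.prod (volume : Measure ℝ)), w.swap ∈ S :=
    (Measure.ae_prod_mem_iff_ae_ae_mem (measurable_swap hSm)).2 hfib
  have h2 : ∀ᵐ z ∂((volume : Measure ℝ).prod μ), z ∈ S := by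
    rw [← Measure.prod_swap]
    exact (ae_map_iff measurable_swap.aemeasurable hSm).2 h1
  filter_upwards [h2] with z hz
  exact tendsto_iff_dist_tendsto_zero.2 hz

omit [NormedSpace ℝ F] in
/-- **Measurability of slice norms.** For a jointly measurable `g : ℝ × X → F` and every
`r ∈ [0, ∞]`, `s ↦ ‖g(s, ·)‖_{L^r(μ)}` is measurable (for `r < ∞` by Tonelli; for `r = ∞` because
`{s | ess sup |g(s,·)| ≤ a} = {s | μ{x | a < |g(s,x)|} = 0}` and sections of measurable sets have
measurable measure). [folklore] -/
theorem measurable_eLpNorm_slice {g : ℝ → X → F} (hg : StronglyMeasurable (uncurry g))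
    (r : ℝ≥0∞) : Measurable fun s => eLpNorm (g s) r μ := by
  rcases eq_or_ne r 0 with rfl | hr0
  · simp only [eLpNorm_exponent_zero]; exact measurable_const
  rcases eq_or_ne r ∞ with rfl | hrtop
  · -- the essential supremum
    simp only [eLpNorm_exponent_top, eLpNormEssSup]
    refine measurable_of_Iic fun a => ?_
    have hT : MeasurableSet {z : ℝ × X | a < ‖uncurry g z‖ₑ} :=
      measurableSet_lt measurable_const hg.enorm
    have hmeas : Measurable fun s : ℝ => μ (Prod.mk s ⁻¹' {z : ℝ × X | a < ‖uncurry g z‖ₑ}) :=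
      measurable_measure_prodMk_left hT
    have hset : (fun s => essSup (fun x => ‖g s x‖ₑ) μ) ⁻¹' Iic a =
        (fun s : ℝ => μ (Prod.mk s ⁻¹' {z : ℝ × X | a < ‖uncurry g z‖ₑ})) ⁻¹' {0} := by
      ext s
      simp only [mem_preimage, mem_Iic, mem_singleton_iff]
      have hpre : Prod.mk s ⁻¹' {z : ℝ × X | a < ‖uncurry g z‖ₑ} = {x | ¬ (‖g s x‖ₑ ≤ a)} := by
        ext x; simp [uncurry]
      rw [hpre, ← ae_iff]
      constructor
      · intro h
        filter_upwards [ENNReal.ae_le_essSup fun x => ‖g s x‖ₑ] with x hx using hx.trans h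
      · intro h
        exact essSup_le_of_ae_le a h
    rw [hset]
    exact hmeas (measurableSet_singleton 0)
  · have hr : 0 < r.toReal := ENNReal.toReal_pos hr0 hrtop
    have h : Measurable fun s => ∫⁻ x, ‖g s x‖ₑ ^ r.toReal ∂μ :=
      (hg.enorm.pow_const _).lintegral_prod_right'
    have h2 : (fun s => eLpNorm (g s) r μ) =
        fun s => (∫⁻ x, ‖g s x‖ₑ ^ r.toReal ∂μ) ^ (1 / r.toReal) := by
      funext s; rw [eLpNorm_eq_lintegral_rpow_enorm_toReal hr0 hrtop]
    rw [h2]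
    exact h.pow_const _

omit [NormedSpace ℝ F] in
/-- **A.e.-measurability of slice norms** of an a.e. jointly measurable field on `S × X`:
`s ↦ ‖u(s, ·)‖_{L^r(μ)}` is a.e.-measurable on `S` (pass to a jointly measurable version, whose
slices agree with those of `u` a.e. for a.e. `s`). [folklore] -/
theorem aemeasurable_eLpNorm_slice {S : Set ℝ} {u : ℝ → X → F}
    (hu : AEStronglyMeasurable (uncurry u) ((volume.restrict S).prod μ)) (r : ℝ≥0∞) :
    AEMeasurable (fun s => eLpNorm (u s) r μ) (volume.restrict S) := by
  set ut : ℝ × X → F := hu.mk (uncurry u) with hut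
  have hslice : ∀ᵐ s ∂(volume.restrict S), ∀ᵐ x ∂μ, uncurry u (s, x) = ut (s, x) :=
    Measure.ae_ae_of_ae_prod hu.ae_eq_mk
  have hm : Measurable fun s => eLpNorm (fun x => ut (s, x)) r μ :=
    measurable_eLpNorm_slice (g := fun s x => ut (s, x)) hu.stronglyMeasurable_mk r
  refine (hm.aemeasurable.mono_measure Measure.restrict_le_self).congr ?_
  · filter_upwards [hslice] with s hs
    exact eLpNorm_congr_ae (by filter_upwards [hs] with x hx; exact hx.symm)

end TimeMollification

/-! ### Mollified pairings -/

section Pairing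

variable {X : Type*} [MeasurableSpace X] {μ : Measure X} [SFinite μ]
variable {V : Type*} [NormedAddCommGroup V] [InnerProductSpace ℝ V] [CompleteSpace V]

omit [InnerProductSpace ℝ V] [CompleteSpace V] in
/-- Cauchy–Schwarz: `∫⁻ ‖F‖ ‖G‖ ≤ ‖F‖₂ ‖G‖₂`. [folklore] -/
theorem lintegral_enorm_mul_enorm_le_eLpNorm_mul {Ω : Type*} [MeasurableSpace Ω] {π : Measure Ω}
    {W : Type*} [NormedAddCommGroup W] {F : Ω → V} {G : Ω → W} (hF : AEStronglyMeasurable F π)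
    (hG : AEStronglyMeasurable G π) :
    ∫⁻ ω, ‖F ω‖ₑ * ‖G ω‖ₑ ∂π ≤ eLpNorm F 2 π * eLpNorm G 2 π := by
  calc ∫⁻ ω, ‖F ω‖ₑ * ‖G ω‖ₑ ∂π
      ≤ (∫⁻ ω, ‖F ω‖ₑ ^ (2 : ℝ) ∂π) ^ (1 / (2 : ℝ)) * (∫⁻ ω, ‖G ω‖ₑ ^ (2 : ℝ) ∂π) ^ (1 / (2 : ℝ)) :=
        ENNReal.lintegral_mul_le_Lp_mul_Lq π Real.HolderConjugate.two_two hF.enorm hG.enorm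
    _ = eLpNorm F 2 π * eLpNorm G 2 π := by
        rw [eLpNorm_eq_lintegral_rpow_enorm_toReal two_ne_zero ENNReal.ofNat_ne_top,
          eLpNorm_eq_lintegral_rpow_enorm_toReal two_ne_zero ENNReal.ofNat_ne_top,
          ENNReal.toReal_ofNat]

omit [CompleteSpace V] in
/-- Cauchy–Schwarz for the pairing density: `∫⁻ |⟪F, G⟫| ≤ ‖F‖₂ ‖G‖₂`. [folklore] -/
theorem lintegral_enorm_inner_le_eLpNorm_mul {Ω : Type*} [MeasurableSpace Ω] {π : Measure Ω}
    {F G : Ω → V} (hF : AEStronglyMeasurable F π) (hG : AEStronglyMeasurable G π) :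
    ∫⁻ ω, ‖⟪F ω, G ω⟫‖ₑ ∂π ≤ eLpNorm F 2 π * eLpNorm G 2 π := by
  refine le_trans (lintegral_mono fun ω => ?_) (lintegral_enorm_mul_enorm_le_eLpNorm_mul hF hG)
  rw [← ofReal_norm, ← ofReal_norm, ← ofReal_norm, ← ENNReal.ofReal_mul (norm_nonneg _)]
  exact ENNReal.ofReal_le_ofReal (norm_inner_le_norm (𝕜 := ℝ) _ _)

omit [CompleteSpace V] in
/-- `‖∫ ⟪F, G⟫‖ₑ ≤ ‖F‖₂ ‖G‖₂`. [folklore] -/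
theorem enorm_integral_inner_le_eLpNorm_mul {Ω : Type*} [MeasurableSpace Ω] {π : Measure Ω}
    {F G : Ω → V} (hF : AEStronglyMeasurable F π) (hG : AEStronglyMeasurable G π) :
    ‖∫ ω, ⟪F ω, G ω⟫ ∂π‖ₑ ≤ eLpNorm F 2 π * eLpNorm G 2 π :=
  (enorm_integral_le_lintegral_enorm _).trans (lintegral_enorm_inner_le_eLpNorm_mul hF hG)

omit [CompleteSpace V] in
/-- The pairing density `⟪F, G⟫` of two `L²` fields is integrable. [folklore] -/
theorem integrable_inner_of_eLpNorm_two_lt_top {Ω : Type*} [MeasurableSpace Ω] {π : Measure Ω}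
    {F G : Ω → V} (hF : AEStronglyMeasurable F π) (hG : AEStronglyMeasurable G π)
    (hF2 : eLpNorm F 2 π < ∞) (hG2 : eLpNorm G 2 π < ∞) :
    Integrable (fun ω => ⟪F ω, G ω⟫) π :=
  ⟨hF.inner hG, (lintegral_enorm_inner_le_eLpNorm_mul hF hG).trans_lt (ENNReal.mul_lt_top hF2 hG2)⟩

omit [InnerProductSpace ℝ V] [CompleteSpace V] in
/-- Tonelli for slice norms: `∫⁻ ‖A(σ,·)‖₂² dν(σ) = ‖A‖²_{L²(ν × μ)}`. [folklore] -/
theorem lintegral_eLpNorm_slice_sq {ν : Measure ℝ} [SFinite ν] {A : ℝ → X → V}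
    (hA : StronglyMeasurable (uncurry A)) :
    ∫⁻ σ, eLpNorm (A σ) 2 μ ^ (2 : ℝ) ∂ν = eLpNorm (uncurry A) 2 (ν.prod μ) ^ (2 : ℝ) := by
  rw [eLpNorm_eq_eLpNorm' two_ne_zero ENNReal.ofNat_ne_top, ENNReal.toReal_ofNat,
    ← lintegral_rpow_enorm_eq_rpow_eLpNorm' zero_lt_two,
    lintegral_prod _ (hA.aestronglyMeasurable.enorm.pow_const _)]
  refine lintegral_congr fun σ => ?_
  rw [eLpNorm_eq_eLpNorm' two_ne_zero ENNReal.ofNat_ne_top, ENNReal.toReal_ofNat,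
    ← lintegral_rpow_enorm_eq_rpow_eLpNorm' zero_lt_two]
  rfl

omit [InnerProductSpace ℝ V] [CompleteSpace V] in
/-- The slice norms `σ ↦ ‖A(σ,·)‖₂` of an `L²(ν × μ)` field, `ν` finite, are integrable. [folklore] -/
theorem integrable_toReal_eLpNorm_slice {ν : Measure ℝ} [IsFiniteMeasure ν] {A : ℝ → X → V}
    (hA : StronglyMeasurable (uncurry A)) (hA2 : eLpNorm (uncurry A) 2 (ν.prod μ) < ∞) :
    Integrable (fun σ => (eLpNorm (A σ) 2 μ).toReal) ν := by
  have hm : Measurable fun σ => eLpNorm (A σ) 2 μ := measurable_eLpNorm_slice hA 2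
  refine MemLp.integrable one_le_two ⟨hm.ennreal_toReal.aestronglyMeasurable, ?_⟩
  rw [eLpNorm_eq_lintegral_rpow_enorm_toReal two_ne_zero ENNReal.ofNat_ne_top,
    ENNReal.toReal_ofNat]
  refine ENNReal.rpow_lt_top_of_nonneg (by norm_num) (ne_of_lt ?_)
  calc ∫⁻ σ, ‖(eLpNorm (A σ) 2 μ).toReal‖ₑ ^ (2 : ℝ) ∂ν
      ≤ ∫⁻ σ, eLpNorm (A σ) 2 μ ^ (2 : ℝ) ∂ν := by
        refine lintegral_mono fun σ => ENNReal.rpow_le_rpow ?_ zero_le_two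
        rw [Real.enorm_eq_ofReal ENNReal.toReal_nonneg]
        exact ENNReal.ofReal_toReal_le
    _ = eLpNorm (uncurry A) 2 (ν.prod μ) ^ (2 : ℝ) := lintegral_eLpNorm_slice_sq hA
    _ < ∞ := ENNReal.rpow_lt_top_of_nonneg zero_le_two hA2.ne

omit [InnerProductSpace ℝ V] [CompleteSpace V] in
/-- Almost every slice of an `L²(ν × μ)` field is in `L²(μ)`. [folklore] -/
theorem ae_eLpNorm_slice_lt_top {ν : Measure ℝ} [SFinite ν] {A : ℝ → X → V}
    (hA : StronglyMeasurable (uncurry A)) (hA2 : eLpNorm (uncurry A) 2 (ν.prod μ) < ∞) :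
    ∀ᵐ σ ∂ν, eLpNorm (A σ) 2 μ < ∞ := by
  have hm : Measurable fun σ => eLpNorm (A σ) 2 μ ^ (2 : ℝ) :=
    (measurable_eLpNorm_slice hA 2).pow_const _
  have hfin : ∫⁻ σ, eLpNorm (A σ) 2 μ ^ (2 : ℝ) ∂ν ≠ ∞ := by
    rw [lintegral_eLpNorm_slice_sq hA]
    exact (ENNReal.rpow_lt_top_of_nonneg zero_le_two hA2.ne).ne
  filter_upwards [ae_lt_top hm hfin] with σ hσ
  exact (ENNReal.rpow_lt_top_iff_of_pos zero_lt_two).1 hσ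

omit [InnerProductSpace ℝ V] [CompleteSpace V] in
/-- Almost every time fibre `σ ↦ A(σ, x)` of an `L²(vol × μ)` field is in `L²(ℝ)`. [folklore] -/
theorem ae_eLpNorm_fibre_lt_top {A : ℝ → X → V} (hA : StronglyMeasurable (uncurry A))
    (hA2 : eLpNorm (uncurry A) 2 ((volume : Measure ℝ).prod μ) < ∞) :
    ∀ᵐ x ∂μ, eLpNorm (fun σ => A σ x) 2 volume < ∞ := by
  have hm : Measurable fun x => ∫⁻ σ, ‖A σ x‖ₑ ^ (2 : ℝ) ∂volume :=
    (hA.enorm.pow_const _).lintegral_prod_left'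
  have htot : ∫⁻ x, ∫⁻ σ, ‖A σ x‖ₑ ^ (2 : ℝ) ∂volume ∂μ =
      eLpNorm (uncurry A) 2 ((volume : Measure ℝ).prod μ) ^ (2 : ℝ) := by
    rw [eLpNorm_eq_eLpNorm' two_ne_zero ENNReal.ofNat_ne_top, ENNReal.toReal_ofNat,
      ← lintegral_rpow_enorm_eq_rpow_eLpNorm' zero_lt_two,
      lintegral_prod_symm _ (hA.aestronglyMeasurable.enorm.pow_const _)]
    rfl
  have hfin : ∫⁻ x, ∫⁻ σ, ‖A σ x‖ₑ ^ (2 : ℝ) ∂volume ∂μ ≠ ∞ := by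
    rw [htot]; exact (ENNReal.rpow_lt_top_of_nonneg zero_le_two hA2.ne).ne
  filter_upwards [ae_lt_top hm hfin] with x hx
  rw [eLpNorm_eq_eLpNorm' two_ne_zero ENNReal.ofNat_ne_top, ENNReal.toReal_ofNat,
    ← ENNReal.rpow_lt_top_iff_of_pos zero_lt_two, ← lintegral_rpow_enorm_eq_rpow_eLpNorm' zero_lt_two]
  exact hx

/-- `a ≤ 1 + a²` in `ℝ≥0∞`. [folklore] -/
theorem _root_.ENNReal.le_one_add_rpow_two (a : ℝ≥0∞) : a ≤ 1 + a ^ (2 : ℝ) := by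
  rcases le_total a 1 with h | h
  · exact h.trans le_self_add
  · calc a = a ^ (1 : ℝ) := (ENNReal.rpow_one a).symm
      _ ≤ a ^ (2 : ℝ) := ENNReal.rpow_le_rpow_of_exponent_le h one_le_two
      _ ≤ 1 + a ^ (2 : ℝ) := le_add_self

omit [SFinite μ] in
/-- **Fubini for a weighted pairing.** `∫ ρ(b) (∫ₓ ⟪P(b,x), Q(x)⟫) db = ∫ₓ ⟪∫ ρ(b) P(b,x) db, Q(x)⟫`
when the double integrand is integrable and a.e. fibre `b ↦ ρ(b) P(b,x)` is integrable. [folklore] -/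
theorem integral_mul_integral_inner_eq [SFinite μ] {ρ : ℝ → ℝ} {P : ℝ → X → V} {Q : X → V}
    (hint : Integrable (fun q : ℝ × X => ρ q.1 * ⟪P q.1 q.2, Q q.2⟫) ((volume : Measure ℝ).prod μ))
    (hP : ∀ᵐ x ∂μ, Integrable (fun b => ρ b • P b x) volume) :
    ∫ b, ρ b * ∫ x, ⟪P b x, Q x⟫ ∂μ = ∫ x, ⟪∫ b, ρ b • P b x, Q x⟫ ∂μ := by
  have h1 : ∫ b, ρ b * ∫ x, ⟪P b x, Q x⟫ ∂μ = ∫ b, ∫ x, ρ b * ⟪P b x, Q x⟫ ∂μ := by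
    congr 1; ext b; rw [integral_const_mul]
  rw [h1, integral_integral_swap (f := fun b x => ρ b * ⟪P b x, Q x⟫) hint]
  refine integral_congr_ae ?_
  filter_upwards [hP] with x hx
  calc ∫ b, ρ b * ⟪P b x, Q x⟫ = ∫ b, ⟪Q x, ρ b • P b x⟫ := by
        congr 1; ext b; rw [real_inner_smul_right, real_inner_comm]
    _ = ⟪Q x, ∫ b, ρ b • P b x⟫ := integral_inner hx (Q x)
    _ = ⟪∫ b, ρ b • P b x, Q x⟫ := real_inner_comm _ _

omit [SFinite μ] in
/-- Restricting the first factor of a product measure. [folklore] -/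
theorem restrict_prod_eq [SFinite μ] {ν : Measure ℝ} [SFinite ν] (S : Set ℝ) :
    (ν.prod μ).restrict {z : ℝ × X | z.1 ∈ S} = (ν.restrict S).prod μ := by
  have : {z : ℝ × X | z.1 ∈ S} = S ×ˢ (univ : Set X) := by ext z; simp
  rw [this, Measure.restrict_prod_eq_prod_univ]

/-- The time translate `σ ↦ ρ(s - σ)` of a bump kernel is in every `L^p(ℝ)`. [folklore] -/
theorem memLp_normed_comp_sub (φ : ContDiffBump (0 : ℝ)) (s : ℝ) (p : ℝ≥0∞) :
    MemLp (fun σ => φ.normed volume (s - σ)) p (volume : Measure ℝ) := by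
  have hc : Continuous fun σ => φ.normed volume (s - σ) :=
    φ.continuous_normed.comp (continuous_const.sub continuous_id)
  have hK : HasCompactSupport fun σ => φ.normed volume (s - σ) := by
    have : (fun σ => φ.normed volume (s - σ)) = φ.normed volume ∘ Homeomorph.subLeft s := by
      ext σ; rfl
    rw [this]
    exact φ.hasCompactSupport_normed.comp_homeomorph _
  exact hc.memLp_of_hasCompactSupport hK

/-- **The mollified `L²`–`L²` pairing converges.** Let `A, Φ : ℝ × X → V` be jointly measurable
and square integrable on `(0,t) × X`, and let `ρᵢ` be even normalised bump kernels with
`rOut(ρᵢ) → 0`. Then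
`∫∫_{(0,t)²} ρᵢ(s - σ) ⟨Φ(s), A(σ)⟩_{L²(X)} dσ ds → ∫_{(0,t)} ⟨Φ(s), A(s)⟩_{L²(X)} ds`
(Serrin 1963, §4: the passage to the limit `h → 0` in the time-mollified cross-tested weak
formulations, for the terms that are quadratic in `L²` quantities). Proof: by Fubini the left
side is `⟨Φ, ρᵢ ⋆₁ A⟩_{L²((0,t) × X)}` with `A` extended by zero, and `ρᵢ ⋆₁ A → A` in
`L²(ℝ × X)` (`tendsto_eLpNorm_timeConv_sub`); Cauchy–Schwarz. [cite: Serrin1963, §4] -/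
theorem tendsto_integral_normed_mul_integral_inner {ι : Type*} {φ : ι → ContDiffBump (0 : ℝ)}
    {l : Filter ι} [l.IsCountablyGenerated] (hφ : Tendsto (fun i => (φ i).rOut) l (𝓝 0))
    {t : ℝ} {A Φ : ℝ → X → V} (hA : StronglyMeasurable (uncurry A))
    (hΦ : StronglyMeasurable (uncurry Φ))
    (hA2 : eLpNorm (uncurry A) 2 ((volume.restrict (Ioo 0 t)).prod μ) < ∞)
    (hΦ2 : eLpNorm (uncurry Φ) 2 ((volume.restrict (Ioo 0 t)).prod μ) < ∞) :
    Tendsto (fun i => ∫ p, (φ i).normed volume (p.2 - p.1) * ∫ x, ⟪Φ p.2 x, A p.1 x⟫ ∂μ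
        ∂((volume.restrict (Ioo 0 t)).prod (volume.restrict (Ioo 0 t))))
      l (𝓝 (∫ z, ⟪Φ z.1 z.2, A z.1 z.2⟫ ∂((volume.restrict (Ioo 0 t)).prod μ))) := by
  set S : Set ℝ := Ioo 0 t with hS
  have hSmeas : MeasurableSet S := measurableSet_Ioo
  set ν : Measure ℝ := volume.restrict S with hν
  haveI : IsFiniteMeasure ν := by rw [hν]; infer_instance
  -- zero extension of `A`
  set A' : ℝ → X → V := fun σ x => S.indicator (fun σ => A σ x) σ with hA'
  have hA'eq : uncurry A' = {z : ℝ × X | z.1 ∈ S}.indicator (uncurry A) := by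
    ext z; simp only [hA', uncurry, indicator_apply, mem_setOf_eq]
  have hSm : MeasurableSet {z : ℝ × X | z.1 ∈ S} := hSmeas.preimage measurable_fst
  have hA'm : StronglyMeasurable (uncurry A') := by rw [hA'eq]; exact hA.indicator hSm
  have hA'2 : eLpNorm (uncurry A') 2 ((volume : Measure ℝ).prod μ) =
      eLpNorm (uncurry A) 2 (ν.prod μ) := by
    rw [hA'eq, eLpNorm_indicator_eq_eLpNorm_restrict hSm, restrict_prod_eq]
  have hA'mem : ∀ {σ}, σ ∈ S → A' σ = A σ := fun hσ => by
    ext x; simp [hA', indicator_of_mem hσ]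
  have hA'nmem : ∀ {σ}, σ ∉ S → A' σ = 0 := fun hσ => by
    ext x; simp [hA', indicator_of_notMem hσ]
  have hA'σ : ∀ σ, eLpNorm (A' σ) 2 μ = S.indicator (fun σ => eLpNorm (A σ) 2 μ) σ := by
    intro σ
    by_cases hσ : σ ∈ S
    · rw [indicator_of_mem hσ, hA'mem hσ]
    · rw [indicator_of_notMem hσ, hA'nmem hσ, eLpNorm_zero]
  have hle : ν.prod μ ≤ (volume : Measure ℝ).prod μ := by
    rw [← restrict_prod_eq]; exact Measure.restrict_le_self
  -- the mollifications
  set M : ι → ℝ × X → V := fun i z =>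
    ((φ i).normed volume ⋆[lsmul ℝ ℝ, volume] fun σ => A' σ z.2) z.1 with hM
  have hMm : ∀ i, StronglyMeasurable (M i) := fun i => stronglyMeasurable_timeConv (φ i) hA'm
  have hM2 : ∀ i, eLpNorm (M i) 2 ((volume : Measure ℝ).prod μ) < ∞ := fun i =>
    (eLpNorm_timeConv_le (μ := μ) (φ i) hA'm one_le_two ENNReal.ofNat_ne_top).trans_lt
      (by rw [hA'2]; exact hA2)
  have hconv : Tendsto (fun i => eLpNorm (fun z : ℝ × X => M i z - A' z.1 z.2) 2
      ((volume : Measure ℝ).prod μ)) l (𝓝 0) :=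
    tendsto_eLpNorm_timeConv_sub hφ hA'm one_le_two ENNReal.ofNat_ne_top
      (by rw [hA'2]; exact hA2)
  have hD2 : ∀ i, eLpNorm (fun z : ℝ × X => M i z - A' z.1 z.2) 2
      ((volume : Measure ℝ).prod μ) < ∞ := fun i =>
    (eLpNorm_sub_le (hMm i).aestronglyMeasurable hA'm.aestronglyMeasurable one_le_two).trans_lt
      (ENNReal.add_lt_top.2 ⟨hM2 i, by rw [hA'2]; exact hA2⟩)
  -- slice norms
  set a : ℝ → ℝ≥0∞ := fun σ => eLpNorm (A σ) 2 μ with ha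
  set b : ℝ → ℝ≥0∞ := fun s => eLpNorm (Φ s) 2 μ with hb
  have ham : Measurable a := measurable_eLpNorm_slice hA 2
  have hai : Integrable (fun σ => (a σ).toReal) ν := integrable_toReal_eLpNorm_slice hA hA2
  have hbi : Integrable (fun s => (b s).toReal) ν := integrable_toReal_eLpNorm_slice hΦ hΦ2
  have ha_fin : ∀ᵐ σ ∂ν, a σ < ∞ := ae_eLpNorm_slice_lt_top hA hA2
  have hb_fin : ∀ᵐ s ∂ν, b s < ∞ := ae_eLpNorm_slice_lt_top hΦ hΦ2
  have ha_int : ∫⁻ σ in S, a σ < ∞ := by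
    have h2 : ∫⁻ σ, a σ ^ (2 : ℝ) ∂ν < ∞ := by
      rw [lintegral_eLpNorm_slice_sq hA]
      exact ENNReal.rpow_lt_top_of_nonneg zero_le_two hA2.ne
    calc ∫⁻ σ in S, a σ ≤ ∫⁻ σ, 1 + a σ ^ (2 : ℝ) ∂ν :=
          lintegral_mono fun σ => ENNReal.le_one_add_rpow_two _
      _ = ν univ + ∫⁻ σ, a σ ^ (2 : ℝ) ∂ν := by
          rw [lintegral_add_left measurable_const, lintegral_const, one_mul]
      _ < ∞ := ENNReal.add_lt_top.2 ⟨measure_lt_top _ _, h2⟩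
  have hA'x : ∀ᵐ x ∂μ, eLpNorm (fun σ => A' σ x) 2 volume < ∞ :=
    ae_eLpNorm_fibre_lt_top hA'm (by rw [hA'2]; exact hA2)
  -- measurability of slices and of the pairing `I`
  have hAσ : ∀ σ, AEStronglyMeasurable (A σ) μ := fun σ =>
    ((hA.of_uncurry_left (x := σ))).aestronglyMeasurable
  have hA'σm : ∀ σ, AEStronglyMeasurable (A' σ) μ := fun σ =>
    ((hA'm.of_uncurry_left (x := σ))).aestronglyMeasurable
  have hΦs : ∀ s, AEStronglyMeasurable (Φ s) μ := fun s =>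
    ((hΦ.of_uncurry_left (x := s))).aestronglyMeasurable
  have hIm : StronglyMeasurable fun p : ℝ × ℝ => ∫ x, ⟪Φ p.2 x, A p.1 x⟫ ∂μ := by
    have h : StronglyMeasurable fun q : (ℝ × ℝ) × X => ⟪Φ q.1.2 q.2, A q.1.1 q.2⟫ :=
      (hΦ.comp_measurable (measurable_fst.snd.prodMk measurable_snd)).inner
        (hA.comp_measurable (measurable_fst.fst.prodMk measurable_snd))
    exact h.integral_prod_right'
  have hIbound : ∀ p : ℝ × ℝ, ‖∫ x, ⟪Φ p.2 x, A p.1 x⟫ ∂μ‖ₑ ≤ b p.2 * a p.1 := fun p =>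
    enorm_integral_inner_le_eLpNorm_mul (hΦs p.2) (hAσ p.1)
  -- integrability of the limit pairings on `ν × μ`
  have hΦm' : AEStronglyMeasurable (fun z : ℝ × X => Φ z.1 z.2) (ν.prod μ) :=
    hΦ.aestronglyMeasurable
  have hint4 : ∀ i, Integrable (fun z : ℝ × X => ⟪Φ z.1 z.2, M i z⟫) (ν.prod μ) := fun i =>
    integrable_inner_of_eLpNorm_two_lt_top hΦm' (hMm i).aestronglyMeasurable hΦ2
      ((eLpNorm_mono_measure _ hle).trans_lt (hM2 i))
  have hA'2ν : eLpNorm (uncurry A') 2 (ν.prod μ) < ∞ :=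
    (eLpNorm_mono_measure (uncurry A') hle).trans_lt (by rw [hA'2]; exact hA2)
  have hintA : Integrable (fun z : ℝ × X => ⟪Φ z.1 z.2, A' z.1 z.2⟫) (ν.prod μ) :=
    integrable_inner_of_eLpNorm_two_lt_top hΦm' hA'm.aestronglyMeasurable hΦ2 hA'2ν
  -- ### the key identity, for every `i`
  have hKI : ∀ i, (∫ p, (φ i).normed volume (p.2 - p.1) * ∫ x, ⟪Φ p.2 x, A p.1 x⟫ ∂μ
      ∂(ν.prod ν)) = ∫ z, ⟪Φ z.1 z.2, M i z⟫ ∂(ν.prod μ) := by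
    intro i
    obtain ⟨C, hC0, hC⟩ := exists_normed_le (φ i)
    set ρ : ℝ → ℝ := (φ i).normed volume with hρ
    have hρc : Continuous ρ := (φ i).continuous_normed
    have hρ0 : ∀ x, 0 ≤ ρ x := (φ i).nonneg_normed
    -- integrability on the square
    have hH : Integrable (fun p : ℝ × ℝ => ρ (p.2 - p.1) * ∫ x, ⟪Φ p.2 x, A p.1 x⟫ ∂μ)
        (ν.prod ν) := by
      have hm : AEStronglyMeasurable
          (fun p : ℝ × ℝ => ρ (p.2 - p.1) * ∫ x, ⟪Φ p.2 x, A p.1 x⟫ ∂μ) (ν.prod ν) :=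
        ((hρc.comp (continuous_snd.sub continuous_fst)).aestronglyMeasurable).mul
          hIm.aestronglyMeasurable
      refine Integrable.mono' ((hai.mul_prod hbi).const_mul C) hm ?_
      have h1 : ∀ᵐ p ∂(ν.prod ν), a p.1 < ∞ :=
        (Measure.quasiMeasurePreserving_fst (μ := ν) (ν := ν)).ae ha_fin
      have h2 : ∀ᵐ p ∂(ν.prod ν), b p.2 < ∞ :=
        (Measure.quasiMeasurePreserving_snd (μ := ν) (ν := ν)).ae hb_fin
      filter_upwards [h1, h2] with p hp1 hp2
      rw [norm_mul, Real.norm_eq_abs, abs_of_nonneg (hρ0 _)]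
      have hI : ‖∫ x, ⟪Φ p.2 x, A p.1 x⟫ ∂μ‖ ≤ (b p.2).toReal * (a p.1).toReal := by
        rw [← toReal_enorm, ← ENNReal.toReal_mul]
        exact ENNReal.toReal_mono (ENNReal.mul_ne_top hp2.ne hp1.ne) (hIbound p)
      calc ρ (p.2 - p.1) * ‖∫ x, ⟪Φ p.2 x, A p.1 x⟫ ∂μ‖
          ≤ C * ((b p.2).toReal * (a p.1).toReal) :=
            mul_le_mul (hC _) hI (norm_nonneg _) hC0
        _ = C * ((a p.1).toReal * (b p.2).toReal) := by ring
    -- step 3: the inner identity for a.e. `s`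
    have hstep3 : ∀ᵐ s ∂ν, ∫ σ, ρ (s - σ) * ∫ x, ⟪Φ s x, A σ x⟫ ∂μ ∂ν =
        ∫ x, ⟪Φ s x, M i (s, x)⟫ ∂μ := by
      filter_upwards [hb_fin] with s hs
      -- (3a) pass to the zero extension and the whole line
      have h3a : ∫ σ, ρ (s - σ) * ∫ x, ⟪Φ s x, A σ x⟫ ∂μ ∂ν =
          ∫ σ, ρ (s - σ) * ∫ x, ⟪A' σ x, Φ s x⟫ ∂μ := by
        rw [hν, ← integral_indicator hSmeas]
        congr 1; ext σ
        by_cases hσ : σ ∈ S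
        · rw [indicator_of_mem hσ, hA'mem hσ]
          congr 1
          exact integral_congr_ae (ae_of_all _ fun x => real_inner_comm _ _)
        · rw [indicator_of_notMem hσ, hA'nmem hσ]
          simp
      -- (3b) integrability of the double integrand at this `s`
      have hint : Integrable (fun q : ℝ × X => ρ (s - q.1) * ⟪A' q.1 q.2, Φ s q.2⟫)
          ((volume : Measure ℝ).prod μ) := by
        have hm1 : AEStronglyMeasurable
            (fun q : ℝ × X => ρ (s - q.1) * ⟪A' q.1 q.2, Φ s q.2⟫)
            ((volume : Measure ℝ).prod μ) :=
          ((hρc.measurable.comp (measurable_const.sub measurable_fst)).aestronglyMeasurable).mul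
            (hA'm.inner (((hΦ.of_uncurry_left (x := s))).comp_measurable
              measurable_snd)).aestronglyMeasurable
        refine ⟨hm1, ?_⟩
        have hpt : ∀ q : ℝ × X, ‖ρ (s - q.1) * ⟪A' q.1 q.2, Φ s q.2⟫‖ₑ ≤
            ENNReal.ofReal C * (‖A' q.1 q.2‖ₑ * ‖Φ s q.2‖ₑ) := by
          intro q
          rw [enorm_mul, Real.enorm_eq_ofReal (hρ0 _)]
          refine mul_le_mul (ENNReal.ofReal_le_ofReal (hC _)) ?_ bot_le bot_le
          rw [← ofReal_norm, ← ofReal_norm, ← ofReal_norm, ← ENNReal.ofReal_mul (norm_nonneg _)]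
          exact ENNReal.ofReal_le_ofReal (norm_inner_le_norm (𝕜 := ℝ) _ _)
        calc ∫⁻ q, ‖ρ (s - q.1) * ⟪A' q.1 q.2, Φ s q.2⟫‖ₑ ∂((volume : Measure ℝ).prod μ)
            ≤ ∫⁻ q, ENNReal.ofReal C * (‖A' q.1 q.2‖ₑ * ‖Φ s q.2‖ₑ)
                ∂((volume : Measure ℝ).prod μ) := lintegral_mono hpt
          _ = ENNReal.ofReal C * ∫⁻ σ, ∫⁻ x, ‖A' σ x‖ₑ * ‖Φ s x‖ₑ ∂μ ∂volume := by
              have haem : AEMeasurable (fun q : ℝ × X => ‖A' q.1 q.2‖ₑ * ‖Φ s q.2‖ₑ)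
                  ((volume : Measure ℝ).prod μ) :=
                (hA'm.aestronglyMeasurable.enorm).mul
                  ((((hΦ.of_uncurry_left (x := s))).comp_measurable
                    measurable_snd).aestronglyMeasurable.enorm)
              rw [lintegral_const_mul' _ _ ENNReal.ofReal_ne_top, lintegral_prod _ haem]
          _ ≤ ENNReal.ofReal C * ∫⁻ σ, eLpNorm (A' σ) 2 μ * b s ∂volume := by
              gcongr with σ
              exact lintegral_enorm_mul_enorm_le_eLpNorm_mul (hA'σm σ) (hΦs s)
          _ = ENNReal.ofReal C * ((∫⁻ σ in S, a σ) * b s) := by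
              rw [lintegral_mul_const' _ _ hs.ne]
              congr 2
              simp_rw [hA'σ]
              rw [lintegral_indicator hSmeas]
          _ < ∞ := ENNReal.mul_lt_top ENNReal.ofReal_lt_top (ENNReal.mul_lt_top ha_int hs)
      -- a.e. fibre integrability
      have hP : ∀ᵐ x ∂μ, Integrable (fun σ => ρ (s - σ) • A' σ x) volume := by
        filter_upwards [hA'x] with x hx
        have h1 : MemLp (fun σ => A' σ x) 2 volume :=
          ⟨((hA'm.of_uncurry_right (y := x))).aestronglyMeasurable, hx⟩
        have h2 : MemLp (fun σ => ρ (s - σ)) 2 (volume : Measure ℝ) :=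
          memLp_normed_comp_sub (φ i) s 2
        have h3 := h1.smul h2 (r := 1)
        exact memLp_one_iff_integrable.1 h3
      rw [h3a, integral_mul_integral_inner_eq (ρ := fun σ => ρ (s - σ)) hint hP]
      refine integral_congr_ae (ae_of_all _ fun x => ?_)
      have hMx : M i (s, x) = ∫ σ, ρ (s - σ) • A' σ x := by
        simp only [hM]
        rw [convolution_eq_swap]
        rfl
      dsimp only
      rw [← hMx, real_inner_comm]
    -- assemble
    rw [integral_prod_symm _ hH, integral_prod _ (hint4 i)]
    exact integral_congr_ae hstep3
  -- ### the limit
  have hAA' : ∀ᵐ z ∂(ν.prod μ), A z.1 z.2 = A' z.1 z.2 := by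
    have : ∀ᵐ z ∂(ν.prod μ), z.1 ∈ S := by
      rw [← restrict_prod_eq]; exact ae_restrict_mem hSm
    filter_upwards [this] with z hz
    rw [hA'mem hz]
  have htarget : ∫ z, ⟪Φ z.1 z.2, A z.1 z.2⟫ ∂(ν.prod μ) =
      ∫ z, ⟪Φ z.1 z.2, A' z.1 z.2⟫ ∂(ν.prod μ) :=
    integral_congr_ae (by filter_upwards [hAA'] with z hz; rw [hz])
  have hest : ∀ i, ‖(∫ z, ⟪Φ z.1 z.2, M i z⟫ ∂(ν.prod μ)) -
      ∫ z, ⟪Φ z.1 z.2, A' z.1 z.2⟫ ∂(ν.prod μ)‖ ≤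
      (eLpNorm (uncurry Φ) 2 (ν.prod μ) *
        eLpNorm (fun z : ℝ × X => M i z - A' z.1 z.2) 2 ((volume : Measure ℝ).prod μ)).toReal := by
    intro i
    rw [← integral_sub (hint4 i) hintA]
    have : (fun z : ℝ × X => ⟪Φ z.1 z.2, M i z⟫ - ⟪Φ z.1 z.2, A' z.1 z.2⟫) =
        fun z => ⟪Φ z.1 z.2, M i z - A' z.1 z.2⟫ := by
      ext z; rw [inner_sub_right]
    rw [this, ← toReal_enorm]
    refine ENNReal.toReal_mono (ENNReal.mul_ne_top hΦ2.ne (hD2 i).ne) ?_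
    exact (enorm_integral_inner_le_eLpNorm_mul hΦm'
      ((hMm i).sub hA'm).aestronglyMeasurable).trans
        (mul_le_mul' le_rfl (eLpNorm_mono_measure _ hle))
  have hlim : Tendsto (fun i => (eLpNorm (uncurry Φ) 2 (ν.prod μ) *
      eLpNorm (fun z : ℝ × X => M i z - A' z.1 z.2) 2 ((volume : Measure ℝ).prod μ)).toReal)
      l (𝓝 0) := by
    have h1 := ENNReal.Tendsto.const_mul hconv (Or.inr hΦ2.ne)
    rw [mul_zero] at h1
    have h2 := (ENNReal.tendsto_toReal ENNReal.zero_ne_top).comp h1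
    rwa [ENNReal.toReal_zero] at h2
  have hfin : Tendsto (fun i => (∫ z, ⟪Φ z.1 z.2, M i z⟫ ∂(ν.prod μ)) -
      ∫ z, ⟪Φ z.1 z.2, A' z.1 z.2⟫ ∂(ν.prod μ)) l (𝓝 0) :=
    squeeze_zero_norm' (Eventually.of_forall hest) hlim
  rw [htarget]
  exact (tendsto_sub_nhds_zero_iff.1 hfin).congr fun i => (hKI i).symm

omit [CompleteSpace V] in
/-- Mollification of a bounded field is bounded by the same constant (`ρ ≥ 0`, `∫ ρ = 1`). [folklore] -/
theorem norm_normed_convolution_le_of_bound (φ : ContDiffBump (0 : ℝ)) {h : ℝ → V} {C : ℝ}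
    (hC : ∀ σ, ‖h σ‖ ≤ C) (s : ℝ) : ‖(φ.normed volume ⋆[lsmul ℝ ℝ, volume] h) s‖ ≤ C := by
  rw [convolution_def]
  have hi : Integrable (fun τ => φ.normed volume τ * C) (volume : Measure ℝ) :=
    φ.integrable_normed.mul_const C
  calc ‖∫ τ, (lsmul ℝ ℝ) (φ.normed volume τ) (h (s - τ))‖ ≤ ∫ τ, φ.normed volume τ * C := by
        refine norm_integral_le_of_norm_le hi (ae_of_all _ fun τ => ?_)
        rw [lsmul_apply, norm_smul, Real.norm_eq_abs, abs_of_nonneg (φ.nonneg_normed _)]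
        exact mul_le_mul_of_nonneg_left (hC _) (φ.nonneg_normed _)
    _ = C := by rw [integral_mul_const, φ.integral_normed, one_mul]

/-- **The mollified `L¹`–`L^∞` pairing converges.** Let `A : ℝ × X → V` be jointly measurable and
integrable on `(0,t) × X`, `Φ : ℝ × X → V` jointly measurable and bounded, and let `ρₙ` be even
normalised bump kernels with `rOut → 0`, `rOut ≤ 2 rIn`. Then
`∫∫_{(0,t)²} ρₙ(s - σ) ⟨Φ(s), A(σ)⟩ dσ ds → ∫_{(0,t)} ⟨Φ(s), A(s)⟩ ds`
(Serrin 1963, §4: the limit `h → 0` in the trilinear term, after truncation of the Serrin-class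
factor). Proof: by Fubini and evenness the left side is `∫ ⟨(ρₙ ⋆₁ Φ)(σ), A(σ)⟩ dσ` with `Φ`
extended by zero; `ρₙ ⋆₁ Φ → Φ` a.e. (`ae_tendsto_timeConv`) with the uniform bound `sup |Φ|`,
so dominated convergence against `A ∈ L¹` applies. [cite: Serrin1963, §4] -/
theorem tendsto_integral_normed_mul_integral_inner_of_bound {φ : ℕ → ContDiffBump (0 : ℝ)}
    (hφ : Tendsto (fun n => (φ n).rOut) atTop (𝓝 0)) (h'φ : ∀ n, (φ n).rOut ≤ 2 * (φ n).rIn)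
    {t : ℝ} {A Φ : ℝ → X → V} (hA : StronglyMeasurable (uncurry A))
    (hΦ : StronglyMeasurable (uncurry Φ))
    (hA1 : Integrable (uncurry A) ((volume.restrict (Ioo 0 t)).prod μ))
    {C : ℝ} (hΦC : ∀ s x, ‖Φ s x‖ ≤ C) :
    Tendsto (fun n => ∫ p, (φ n).normed volume (p.2 - p.1) * ∫ x, ⟪Φ p.2 x, A p.1 x⟫ ∂μ
        ∂((volume.restrict (Ioo 0 t)).prod (volume.restrict (Ioo 0 t))))
      atTop (𝓝 (∫ z, ⟪Φ z.1 z.2, A z.1 z.2⟫ ∂((volume.restrict (Ioo 0 t)).prod μ))) := by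
  set S : Set ℝ := Ioo 0 t with hS
  have hSmeas : MeasurableSet S := measurableSet_Ioo
  set ν : Measure ℝ := volume.restrict S with hν
  haveI : IsFiniteMeasure ν := by rw [hν]; infer_instance
  -- a nonnegative bound
  set C' : ℝ := max C 0 with hC'
  have hC'0 : 0 ≤ C' := le_max_right _ _
  have hΦC' : ∀ s x, ‖Φ s x‖ ≤ C' := fun s x => (hΦC s x).trans (le_max_left _ _)
  -- zero extension of `Φ` in time
  set Φ' : ℝ → X → V := fun s x => S.indicator (fun s => Φ s x) s with hΦ'
  have hΦ'eq : uncurry Φ' = {z : ℝ × X | z.1 ∈ S}.indicator (uncurry Φ) := by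
    ext z; simp only [hΦ', uncurry, indicator_apply, mem_setOf_eq]
  have hSm : MeasurableSet {z : ℝ × X | z.1 ∈ S} := hSmeas.preimage measurable_fst
  have hΦ'm : StronglyMeasurable (uncurry Φ') := by rw [hΦ'eq]; exact hΦ.indicator hSm
  have hΦ'C : ∀ s x, ‖Φ' s x‖ ≤ C' := fun s x =>
    (norm_indicator_le_norm_self (f := fun s => Φ s x) _).trans (hΦC' s x)
  have hΦ'mem : ∀ {s}, s ∈ S → Φ' s = Φ s := fun hs => by
    ext x; simp [hΦ', indicator_of_mem hs]
  have hΦ'nmem : ∀ {s}, s ∉ S → Φ' s = 0 := fun hs => by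
    ext x; simp [hΦ', indicator_of_notMem hs]
  have hle : ν.prod μ ≤ (volume : Measure ℝ).prod μ := by
    rw [← restrict_prod_eq]; exact Measure.restrict_le_self
  -- the mollified test fields
  set MΦ : ℕ → ℝ × X → V := fun n z =>
    ((φ n).normed volume ⋆[lsmul ℝ ℝ, volume] fun s => Φ' s z.2) z.1 with hMΦ
  have hMΦm : ∀ n, StronglyMeasurable (MΦ n) := fun n => stronglyMeasurable_timeConv (φ n) hΦ'm
  have hMΦC : ∀ n z, ‖MΦ n z‖ ≤ C' := fun n z =>
    norm_normed_convolution_le_of_bound (φ n) (fun s => hΦ'C s z.2) z.1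
  -- a.e. convergence of the mollified test fields
  have hae : ∀ᵐ z ∂(ν.prod μ), Tendsto (fun n => MΦ n z) atTop (𝓝 (Φ' z.1 z.2)) := by
    have hloc : ∀ᵐ x ∂μ, LocallyIntegrable (fun s => Φ' s x) volume :=
      ae_of_all _ fun x => (memLp_top_of_bound
        ((hΦ'm.of_uncurry_right (y := x))).aestronglyMeasurable C'
          (ae_of_all _ fun s => hΦ'C s x)).locallyIntegrable le_top
    exact (ae_tendsto_timeConv hφ h'φ hΦ'm hloc).filter_mono (ae_mono hle)
  -- integrability facts for `A`
  have hAσi : ∀ᵐ σ ∂ν, Integrable (A σ) μ := hA1.prod_right_ae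
  have ha1 : Integrable (fun σ => ∫ x, ‖A σ x‖ ∂μ) ν := hA1.integral_norm_prod_left
  have hAσ : ∀ σ, AEStronglyMeasurable (A σ) μ := fun σ =>
    ((hA.of_uncurry_left (x := σ))).aestronglyMeasurable
  have hΦs : ∀ s, AEStronglyMeasurable (Φ s) μ := fun s =>
    ((hΦ.of_uncurry_left (x := s))).aestronglyMeasurable
  have hIm : StronglyMeasurable fun p : ℝ × ℝ => ∫ x, ⟪Φ p.2 x, A p.1 x⟫ ∂μ := by
    have h : StronglyMeasurable fun q : (ℝ × ℝ) × X => ⟪Φ q.1.2 q.2, A q.1.1 q.2⟫ :=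
      (hΦ.comp_measurable (measurable_fst.snd.prodMk measurable_snd)).inner
        (hA.comp_measurable (measurable_fst.fst.prodMk measurable_snd))
    exact h.integral_prod_right'
  have hIbound : ∀ p : ℝ × ℝ, Integrable (A p.1) μ →
      ‖∫ x, ⟪Φ p.2 x, A p.1 x⟫ ∂μ‖ ≤ C' * ∫ x, ‖A p.1 x‖ ∂μ := by
    intro p hp
    rw [← integral_const_mul]
    refine norm_integral_le_of_norm_le (hp.norm.const_mul C') (ae_of_all _ fun x => ?_)
    exact (norm_inner_le_norm (𝕜 := ℝ) _ _).trans
      (mul_le_mul_of_nonneg_right (hΦC' _ _) (norm_nonneg _))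
  -- integrability of the mollified pairings on `ν × μ`
  have hint5 : ∀ n, Integrable (fun z : ℝ × X => ⟪MΦ n z, A z.1 z.2⟫) (ν.prod μ) := by
    intro n
    refine Integrable.mono' (hA1.norm.const_mul C')
      (((hMΦm n).inner hA).aestronglyMeasurable) (ae_of_all _ fun z => ?_)
    exact (norm_inner_le_norm (𝕜 := ℝ) _ _).trans
      (mul_le_mul_of_nonneg_right (hMΦC n z) (norm_nonneg _))
  -- ### the key identity
  have hKI : ∀ n, (∫ p, (φ n).normed volume (p.2 - p.1) * ∫ x, ⟪Φ p.2 x, A p.1 x⟫ ∂μ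
      ∂(ν.prod ν)) = ∫ z, ⟪MΦ n z, A z.1 z.2⟫ ∂(ν.prod μ) := by
    intro n
    obtain ⟨Cρ, hCρ0, hCρ⟩ := exists_normed_le (φ n)
    set ρ : ℝ → ℝ := (φ n).normed volume with hρ
    have hρc : Continuous ρ := (φ n).continuous_normed
    have hρ0 : ∀ x, 0 ≤ ρ x := (φ n).nonneg_normed
    -- integrability on the square
    have hH : Integrable (fun p : ℝ × ℝ => ρ (p.2 - p.1) * ∫ x, ⟪Φ p.2 x, A p.1 x⟫ ∂μ)
        (ν.prod ν) := by
      have hm : AEStronglyMeasurable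
          (fun p : ℝ × ℝ => ρ (p.2 - p.1) * ∫ x, ⟪Φ p.2 x, A p.1 x⟫ ∂μ) (ν.prod ν) :=
        ((hρc.comp (continuous_snd.sub continuous_fst)).aestronglyMeasurable).mul
          hIm.aestronglyMeasurable
      refine Integrable.mono' ((ha1.mul_prod (integrable_const (1 : ℝ))).const_mul (Cρ * C'))
        hm ?_
      have h1 : ∀ᵐ p ∂(ν.prod ν), Integrable (A p.1) μ :=
        (Measure.quasiMeasurePreserving_fst (μ := ν) (ν := ν)).ae hAσi
      filter_upwards [h1] with p hp
      rw [norm_mul, Real.norm_eq_abs, abs_of_nonneg (hρ0 _), mul_one]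
      calc ρ (p.2 - p.1) * ‖∫ x, ⟪Φ p.2 x, A p.1 x⟫ ∂μ‖
          ≤ Cρ * (C' * ∫ x, ‖A p.1 x‖ ∂μ) :=
            mul_le_mul (hCρ _) (hIbound p hp) (norm_nonneg _) hCρ0
        _ = Cρ * C' * ∫ x, ‖A p.1 x‖ ∂μ := by ring
    -- step 3: the inner identity for a.e. `σ`
    have hstep3 : ∀ᵐ σ ∂ν, ∫ s, ρ (s - σ) * ∫ x, ⟪Φ s x, A σ x⟫ ∂μ ∂ν =
        ∫ x, ⟪MΦ n (σ, x), A σ x⟫ ∂μ := by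
      filter_upwards [hAσi] with σ hσi
      -- (3a) zero extension, whole line, evenness
      have h3a : ∫ s, ρ (s - σ) * ∫ x, ⟪Φ s x, A σ x⟫ ∂μ ∂ν =
          ∫ s, ρ (σ - s) * ∫ x, ⟪Φ' s x, A σ x⟫ ∂μ := by
        rw [hν, ← integral_indicator hSmeas]
        congr 1; ext s
        rw [show ρ (σ - s) = ρ (s - σ) from normed_sub_comm (φ n) σ s]
        by_cases hs : s ∈ S
        · rw [indicator_of_mem hs, hΦ'mem hs]
        · rw [indicator_of_notMem hs, hΦ'nmem hs]
          simp
      -- (3b) integrability of the double integrand at this `σ`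
      have hρσ : Integrable (fun s => ρ (σ - s)) (volume : Measure ℝ) :=
        memLp_one_iff_integrable.1 (memLp_normed_comp_sub (φ n) σ 1)
      have hint : Integrable (fun q : ℝ × X => ρ (σ - q.1) * ⟪Φ' q.1 q.2, A σ q.2⟫)
          ((volume : Measure ℝ).prod μ) := by
        have hm1 : AEStronglyMeasurable
            (fun q : ℝ × X => ρ (σ - q.1) * ⟪Φ' q.1 q.2, A σ q.2⟫)
            ((volume : Measure ℝ).prod μ) :=
          ((hρc.measurable.comp (measurable_const.sub measurable_fst)).aestronglyMeasurable).mul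
            (hΦ'm.inner (((hA.of_uncurry_left (x := σ))).comp_measurable
              measurable_snd)).aestronglyMeasurable
        refine Integrable.mono' (hρσ.mul_prod (hσi.norm.const_mul C')) hm1
          (ae_of_all _ fun q => ?_)
        rw [norm_mul, Real.norm_eq_abs, abs_of_nonneg (hρ0 _)]
        refine mul_le_mul_of_nonneg_left ?_ (hρ0 _)
        exact (norm_inner_le_norm (𝕜 := ℝ) _ _).trans
          (mul_le_mul_of_nonneg_right (hΦ'C _ _) (norm_nonneg _))
      have hP : ∀ᵐ x ∂μ, Integrable (fun s => ρ (σ - s) • Φ' s x) volume :=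
        ae_of_all _ fun x => hρσ.smul_of_top_left (memLp_top_of_bound
          ((hΦ'm.of_uncurry_right (y := x))).aestronglyMeasurable C'
            (ae_of_all _ fun s => hΦ'C s x))
      rw [h3a, integral_mul_integral_inner_eq (ρ := fun s => ρ (σ - s)) hint hP]
      refine integral_congr_ae (ae_of_all _ fun x => ?_)
      have hMx : MΦ n (σ, x) = ∫ s, ρ (σ - s) • Φ' s x := by
        simp only [hMΦ]
        rw [convolution_eq_swap]
        rfl
      dsimp only
      rw [← hMx]
    -- assemble
    rw [integral_prod _ hH, integral_prod _ (hint5 n)]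
    exact integral_congr_ae hstep3
  -- ### the limit by dominated convergence
  have hDCT : Tendsto (fun n => ∫ z, ⟪MΦ n z, A z.1 z.2⟫ ∂(ν.prod μ)) atTop
      (𝓝 (∫ z, ⟪Φ' z.1 z.2, A z.1 z.2⟫ ∂(ν.prod μ))) := by
    refine tendsto_integral_of_dominated_convergence (fun z => C' * ‖A z.1 z.2‖)
      (fun n => ((hMΦm n).inner hA).aestronglyMeasurable) (hA1.norm.const_mul C')
      (fun n => ae_of_all _ fun z => ?_) ?_
    · exact (norm_inner_le_norm (𝕜 := ℝ) _ _).trans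
        (mul_le_mul_of_nonneg_right (hMΦC n z) (norm_nonneg _))
    · filter_upwards [hae] with z hz
      exact hz.inner tendsto_const_nhds
  have htarget : ∫ z, ⟪Φ z.1 z.2, A z.1 z.2⟫ ∂(ν.prod μ) =
      ∫ z, ⟪Φ' z.1 z.2, A z.1 z.2⟫ ∂(ν.prod μ) := by
    have : ∀ᵐ z ∂(ν.prod μ), z.1 ∈ S := by
      rw [← restrict_prod_eq]; exact ae_restrict_mem hSm
    refine integral_congr_ae ?_
    filter_upwards [this] with z hz
    rw [hΦ'mem hz]
  rw [htarget]
  exact hDCT.congr fun n => (hKI n).symm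

end Pairing

/-! ### A weighted Hölder inequality for the mollifying kernel -/

section Weighted

/-- The unit mass of the kernel in `ℝ≥0∞`, translated: `∫⁻ ofReal ρ(s - σ) ds = 1`. [folklore] -/
theorem lintegral_ofReal_normed_sub_right (φ : ContDiffBump (0 : ℝ)) (σ : ℝ) :
    ∫⁻ s, ENNReal.ofReal (φ.normed volume (s - σ)) ∂(volume : Measure ℝ) = 1 := by
  rw [lintegral_sub_right_eq_self (fun s => ENNReal.ofReal (φ.normed volume s)) σ,
    ← ofReal_integral_eq_lintegral_ofReal φ.integrable_normed
      (ae_of_all _ φ.nonneg_normed), φ.integral_normed, ENNReal.ofReal_one]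

/-- The unit mass of the kernel in `ℝ≥0∞`, reflected: `∫⁻ ofReal ρ(s - σ) dσ = 1`. [folklore] -/
theorem lintegral_ofReal_normed_sub_left (φ : ContDiffBump (0 : ℝ)) (s : ℝ) :
    ∫⁻ σ, ENNReal.ofReal (φ.normed volume (s - σ)) ∂(volume : Measure ℝ) = 1 := by
  simp_rw [normed_sub_comm φ s]
  exact lintegral_ofReal_normed_sub_right φ s

/-- **Weighted Hölder inequality for the mollifying kernel.** For `ν₁, ν₂ ≤ vol` on `ℝ`,
nonnegative `f, g` and conjugate exponents `1 < p, q < ∞`,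
`∫∫ ρ(s - σ) f(σ) g(s) dν₂(s) dν₁(σ) ≤ ‖f‖_{L^p(ν₁)} ‖g‖_{L^q(ν₂)}`
(Hölder on `ν₁ × ν₂` for `(ρ^{1/p} f) · (ρ^{1/q} g)` and `∫ ρ(s - σ) ds = ∫ ρ(s - σ) dσ = 1`;
the form of Young's inequality used by Serrin 1963, §4, to bound the trilinear remainder
uniformly in the mollification parameter). [cite: Serrin1963, §4] -/
theorem lintegral_lintegral_normed_mul_mul_le (φ : ContDiffBump (0 : ℝ)) {ν₁ ν₂ : Measure ℝ}
    [SFinite ν₁] [SFinite ν₂] (hν₁ : ν₁ ≤ volume) (hν₂ : ν₂ ≤ volume)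
    {f g : ℝ → ℝ≥0∞} (hf : AEMeasurable f ν₁) (hg : AEMeasurable g ν₂)
    {p q : ℝ} (hpq : p.HolderConjugate q) :
    ∫⁻ σ, ∫⁻ s, ENNReal.ofReal (φ.normed volume (s - σ)) * (f σ * g s) ∂ν₂ ∂ν₁ ≤
      (∫⁻ σ, f σ ^ p ∂ν₁) ^ (1 / p) * (∫⁻ s, g s ^ q ∂ν₂) ^ (1 / q) := by
  have hp0 : 0 < p := hpq.pos
  have hq0 : 0 < q := hpq.symm.pos
  set K : ℝ × ℝ → ℝ≥0∞ := fun z => ENNReal.ofReal (φ.normed volume (z.2 - z.1)) with hK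
  have hKm : Measurable K :=
    ENNReal.measurable_ofReal.comp
      (φ.continuous_normed.measurable.comp (measurable_snd.sub measurable_fst))
  -- unit masses
  have hK1 : ∀ σ, ∫⁻ s, K (σ, s) ∂ν₂ ≤ 1 := fun σ =>
    (lintegral_mono' hν₂ le_rfl).trans (lintegral_ofReal_normed_sub_right φ σ).le
  have hK2 : ∀ s, ∫⁻ σ, K (σ, s) ∂ν₁ ≤ 1 := fun s =>
    (lintegral_mono' hν₁ le_rfl).trans (lintegral_ofReal_normed_sub_left φ s).le
  -- the two factors
  set F : ℝ × ℝ → ℝ≥0∞ := fun z => K z ^ (1 / p) * f z.1 with hF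
  set G : ℝ × ℝ → ℝ≥0∞ := fun z => K z ^ (1 / q) * g z.2 with hG
  have hFm : AEMeasurable F (ν₁.prod ν₂) := (hKm.pow_const _).aemeasurable.mul hf.comp_fst
  have hGm : AEMeasurable G (ν₁.prod ν₂) := (hKm.pow_const _).aemeasurable.mul hg.comp_snd
  have hFG : ∀ z, K z * (f z.1 * g z.2) = F z * G z := by
    intro z
    simp only [hF, hG]
    have : K z = K z ^ (1 / p) * K z ^ (1 / q) := by
      rw [← ENNReal.rpow_add_of_nonneg _ _ (by positivity) (by positivity)]
      have h1 : 1 / p + 1 / q = 1 := by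
        rw [one_div, one_div]; exact hpq.inv_add_inv_eq_one
      rw [h1, ENNReal.rpow_one]
    conv_lhs => rw [this]
    ring
  have hFp : ∀ z, F z ^ p = K z * f z.1 ^ p := by
    intro z
    simp only [hF]
    rw [ENNReal.mul_rpow_of_nonneg _ _ hp0.le, ← ENNReal.rpow_mul, one_div,
      inv_mul_cancel₀ hp0.ne', ENNReal.rpow_one]
  have hGq : ∀ z, G z ^ q = K z * g z.2 ^ q := by
    intro z
    simp only [hG]
    rw [ENNReal.mul_rpow_of_nonneg _ _ hq0.le, ← ENNReal.rpow_mul, one_div,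
      inv_mul_cancel₀ hq0.ne', ENNReal.rpow_one]
  -- pass to the product measure
  have haem : AEMeasurable (fun z : ℝ × ℝ => K z * (f z.1 * g z.2)) (ν₁.prod ν₂) :=
    hKm.aemeasurable.mul (hf.comp_fst.mul hg.comp_snd)
  have hprod : ∫⁻ σ, ∫⁻ s, ENNReal.ofReal (φ.normed volume (s - σ)) * (f σ * g s) ∂ν₂ ∂ν₁ =
      ∫⁻ z, K z * (f z.1 * g z.2) ∂(ν₁.prod ν₂) := (lintegral_prod _ haem).symm
  rw [hprod]
  simp_rw [hFG]
  refine (ENNReal.lintegral_mul_le_Lp_mul_Lq _ hpq hFm hGm).trans ?_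
  gcongr
  · -- `∫ F^p ≤ ∫ f^p`
    simp_rw [hFp]
    have h1m : AEMeasurable (fun z : ℝ × ℝ => K z * f z.1 ^ p) (ν₁.prod ν₂) :=
      hKm.aemeasurable.mul ((hf.pow_const p).comp_fst)
    rw [lintegral_prod _ h1m]
    refine lintegral_mono fun σ => ?_
    have hm' : AEMeasurable (fun s => K (σ, s)) ν₂ := (hKm.comp measurable_prodMk_left).aemeasurable
    rw [show (fun s => K (σ, s) * f σ ^ p) = fun s => f σ ^ p * K (σ, s) from
      funext fun s => mul_comm _ _, lintegral_const_mul'' _ hm']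
    exact mul_le_of_le_one_right' (hK1 σ)
  · -- `∫ G^q ≤ ∫ g^q`
    simp_rw [hGq]
    have h2m : AEMeasurable (fun z : ℝ × ℝ => K z * g z.2 ^ q) (ν₁.prod ν₂) :=
      hKm.aemeasurable.mul ((hg.pow_const q).comp_snd)
    rw [lintegral_prod _ h2m,
      lintegral_lintegral_swap (f := fun σ s => K (σ, s) * g s ^ q) h2m]
    refine lintegral_mono fun s => ?_
    have hm' : AEMeasurable (fun σ => K (σ, s)) ν₁ := (hKm.comp measurable_prodMk_right).aemeasurable
    rw [show (fun σ => K (σ, s) * g s ^ q) = fun σ => g s ^ q * K (σ, s) from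
      funext fun σ => mul_comm _ _, lintegral_const_mul'' _ hm']
    exact mul_le_of_le_one_right' (hK2 s)

end Weighted

end Literature.Analysis.FunctionSpaces
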